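import Literature.MathematicalPhysics.QuantumFieldTheory.Balaban1983to89.B9Ineq349SiteReading

/-!
# `Balaban1983to89.Node00.OpsYSectE` — T. Bałaban, *Propagators for lattice gauge theories in a background field*, Commun. Math. Phys. **99**
# (1985) 389–434 [Balaban1985BackgroundPropagators], Sect. E «Unit Lattice Propagators» (3.155)–(3.158) pp. 427–428 and (3.185)–(3.187), Thm 3.15
# p. 432: THE UNIT-LATTICE PROPAGATOR LETTER `C^{(k)}(Λ; U)` OF NODE 00's OPERATOR LAYER ON ITS PRINTED CARRIER (functions on the top-level index
# bonds of `Λ`), BY ITS DEFINITION (3.156)–(3.158) `Δ_k = (QG₁Q*)⁻¹ − a − ⟨D̃⁽²⁾, J⟩`, `C̃^{(k)}(Λ) = (C*Δ_kC)⁻¹`, `C^{(k)}(Λ) = C C̃^{(k)}(Λ) C*` OVER THE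
# v3 LETTERS AND THE RESIDUAL SECT. E LETTERS; THE RIGHT-HAND SIDE OF (3.185) `(I + Dμ)QG̃₂Q*(I + μ*D*)`; THE TWO THM 3.15 SLOTS `GivenBy3185`,
# `HasRWExpC` PINNED (C^{(k)}(Λ) defined by (3.158) EQUALS the (3.185) expression; a (3.99)-type convergent random-walk expansion of its kernel on
# `Λ`); THE LAYER UPDATE `operatorLayerYSectE` AND THE INSTANCE `opsYOfRecordE`

statement-level skeleton of published theorems with citation tags; proofs where landed; nothing here is a claim about the Yang–Mills mass gap

THE PRINT (pp. 427–428, 432; held `paper:balaban1985-cmp99-background-propagators`, journal page = PDF page + 388).  p. 427: *«E. Unit Lattice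
Propagators.  After each renormalization transformation we have to calculate a Gaussian integral. For lattice gauge field theories these Gaussian
measures are defined by covariances, which are unit lattice operators. We need operators with Dirichlet boundary conditions outside some domain Λ
of the unit lattice. We assume that Λ ⊂ Λ_k = Ω_k^{(k)} is a union of big blocks, and a distance between Λ and Λ_kᶜ is bigger than RM. The
covariances are defined by the following Gaussian integrals (3.155) where the operators are defined by the sequence {Ω_j} and a configuration U
satisfying (3.35), (3.36), the function D̃⁽²⁾(B) is a quadratic polynomial in B with properties similar to C⁽²⁾(A), only restricted to unit blocks,
and g is an arbitrary Lie algebra valued function defined at bonds of Λ.»*  p. 428: *«The quadratic form in the above integral can be written also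
as ⟨B, (QG₁Q*)⁻¹B⟩ − a⟨B, B⟩ − 2⟨H₁D̃⁽²⁾(B), J⟩ = ⟨B, Δ_kB⟩. (3.156)  This form is considered on the subspace {B : B = 0 on Λᶜ, B = 0 on
⋃_{y∈Λ′} Ax(y), Q₁B = 0}. We can parametrize this subspace in the same way as in [4] (2.154)–(2.155), using part of the variables B, which we
denote by B̃. These are variables B restricted to the set of bonds Λ̃ = Λ ∖ (⋃_{y∈Λ′} Ax(y) ∪ ⋃_{c∈Λ′} (B(c) ∩ c)). … Variables B depend linearly
on B̃ and we have B = CB̃, where C is a linear operator. It is an identity operator on almost all bonds, except the bonds b₀ for which a value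
(CB̃)(b₀) is equal to a solution of the equation (QB)(c) = 0, considered as an equation on the variable B(b₀). … Of course we have as in (2.155)
[4] … = e^{½⟨C*g, (C*Δ_kC)⁻¹C*g⟩}, (3.157) hence … (C*Δ_kC)⁻¹ = C̃^{(k)}(Λ), C^{(k)}(Λ) = C C̃^{(k)}(Λ) C*. (3.158)  These equalities allow us to express
one of the operators C^{(k)}(Λ), C̃^{(k)}(Λ) by the other.»*  p. 430: *«denoting V = U_k … We denote the linear function defined by the above formulas
by μ(B)»* (3.169).  p. 432: *«Let us denote a covariance operator of the Gaussian integral in (3.183) by G̃₂, then we obtain C^{(k)}(Λ) = (I + Dμ)QG̃₂Q*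
(I + μ*D*). (3.185)  It is the formula we are looking for. … G̃₂ = G₂ − G₂Q̃*(Q̃G₂Q̃*)⁻¹Q̃G₂. (3.186) … Expanding these into random walks we get a random
walk expansion of C^{(k)}(Λ). The formula (3.185) implies immediately bounds and an exponential decay. Thus we get Theorem 3.15.  For Mα₀ sufficiently
small the propagator C^{(k)}(Λ) is given by the formula (3.185), and satisfies the bound |C^{(k)}(Λ; y, y′)| ≤ B₀e^{−δ₀|y−y′|}, y, y′ ∈ Λ (3.187) with the
constants B₀, δ₀ depending on d and L only. This propagator has a convergent random walk expansion of the type described previously.»*  The «type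
described previously» for a KERNEL is Thm 3.9 (3.98)–(3.99) p. 413 (terms indexed by walks ω, each depending on U locally, bounded by
`O(1)(O(1)M^{−½})^{|ω|}M^{−½|ω|}e^{−½δ₀d(ω,y,y′)}` — r1's `B9.RWKernelExpansion` ∕ `B9.walkFactor`).

WHY THIS FILE.  `Node00.OpsYSectDE` (def-Y g3, p492998) built the v3 letters and located (its (M8)) that the interface slot `CovLettersY.Ck : (BlkY → 𝔸) →ₗ
(BlkY → 𝔸)` cannot hold the printed `C^{(k)}(Λ)` — an operator on functions on the unit-lattice BONDS of `Λ`, which on NODE 00's carriers are the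
top-level index bonds `y` with `inΛY x y` (exactly how MODULE 4's `inΛY` ∕ r1's `Thm315FullPrinted` already read `y, y′ ∈ Λ`) — so that row 24 (Thm 3.15)
of the N06 table is vacuous at `opsYOfRecordDE` (`Ck` flat `0`; n06-d's `thm315FullPrinted_of_ker_zero`, n06-m's `t315_opsYOfRecordDE_of_slots`), and its
two `Prop` slots `GivenBy3185 ∕ HasRWExpC` are abstract fields of `ExpLettersY` (dag-ref-E READ-6 (C): «row 24 counts only when the slots are pinned to
(3.185)»).  This file supplies the missing brick WITHOUT touching any interface: a free-standing letter `CkY : CfgY → (IBondY → 𝔸) →ₗ[ℂ] (IBondY → 𝔸)`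
typed from the DEFINITION (3.156)–(3.158) over the v3 letter `(QG₁Q*)⁻¹` (genuine modulo `Δ⁽²⁾`, FILE 7), the weight `a` (FILE 5's `aY`) and a record
`SectELettersY` of the Sect. E objects NODE 00's tree does not have (below, (M-E1)); the right-hand side of (3.185) as an operator on the same carrier;
the slot `GivenBy3185 U := (C^{(k)}(Λ; U) = the (3.185) expression)` — a genuine equation between the two, no longer an abstract `Prop`; the slot
`HasRWExpC U δ₀` := the (3.99)-shaped clause for the kernel of `C^{(k)}(Λ; U)` on `Λ` over a walk-expansion letter; the layer update
`operatorLayerYSectE ops 𝔏 𝔢 𝔴 := { ops with Ck := ⟨kernel of CkY read at the index bonds⟩, GivenBy3185 := …, HasRWExpC := … }` (every other field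
untouched, `rfl`), generic in the base layer `ops`; the instances `opsYOfRecordE` (over `opsYOfRecordDE`) and ★ `opsYOfRecordES` (over n06-i's
`opsYS349OfRecordDE`, `B9Ineq349SiteReading` — THE INSTANCE OF RECORD for the N06 certificate: rows 24 and 25 both read genuine letters).

WHAT IS DEFINED AND PROVED (sorry-free; no inequality of the paper; no `instance`, no new syntax).
* §1 SECTORS (generic finite carrier `X`): `secY 𝔸 S` — multiplication by the indicator of `S ⊂ X` as a `ℂ`-linear map of `X → 𝔸` (Dirichlet
  restriction ∕ extension by zero); `secY_apply_of ∕ _of_not`, `secY_mul_secY_of_imp(')`, `secY_idem`; the COMPLEMENTED CORNER `secCornerY S T :=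
  P T P + (1 − P)` (`P = secY S`) and ★ `secInvY S T := P (secCornerY S T)⁻¹ P` = THE INVERSE OF `T` ON THE FUNCTIONS SUPPORTED IN `S`, EXTENDED BY
  ZERO (`Ring.inverse`; (M-E2)); `secY_mul_secCornerY`, `secCornerY_mul_secY`, `secY_mul_secInvY`, `secInvY_mul_secY`, ★ `corner_mul_secInvY ∕
  secInvY_mul_corner : (PTP)·secInvY = P = secInvY·(PTP)` whenever the corner is a unit.
* §2 `IBondOpY` (a letter on index-bond functions); `secΛY x := secY (inΛY x)` — restriction to the bonds of `Λ` (top-level index bonds with base point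
  in the member's `Λ`), `secΛY_idem`.
* §3 ★ `SectELettersY 𝔸 x` — THE RESIDUAL SECT. E LETTERS at a member (PARAMETERS, (M-E1)): the bond set `Λ̃ ⊂ Λ` of (3.157) (`LamT`, `LamT_inΛ`); the
  operator `D2J U` of the form `B ↦ 2⟨H₁D̃⁽²⁾(B), J⟩` in (3.156) with its printed `U = 1` clause `D2J 1 = 0` (`J = D*η⁻²Im ∂U` vanishes at `U = 1`,
  p. 419); the parametrisation `C` of (3.157) and its adjoint `C*` (`elimC ∕ elimCt`); (3.169)'s `μ(B)` and `μ*` (`mu ∕ muT`, unit-lattice site functions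
  carried on the fine sites); the unit-lattice covariant derivative `D = D_V`, `V = U_k`, of (3.168)–(3.185) and `D*` (`Dbar ∕ DbarT`); the covariance
  `G̃₂` of (3.183)∕(3.186) (`Gt2`); `sectELettersY_flat` (inhabitation only).
* §4 THE DEFINITION, verbatim algebra: ★ `deltaKY x 𝔏 𝔢 U := 𝔏.QG1Qinv U − a − 𝔢.D2J U` (3.156); `elimCΛY ∕ elimCtΛY` (`C` read from `Λ̃`-functions to
  `Λ`-functions: `P_Λ C P_Λ̃`, `P_Λ̃ C* P_Λ` — Dirichlet by construction); `CsDeltaCY := C*Δ_kC` (3.157); ★ `CtildeKY := secInvY Λ̃ (C*Δ_kC)` =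
  `C̃^{(k)}(Λ) = (C*Δ_kC)⁻¹` ON THE `Λ̃`-FUNCTIONS (3.158); ★★ **`CkY x 𝔏 𝔢 U := C C̃^{(k)}(Λ) C*`** = `C^{(k)}(Λ; U)` (3.158); `deltaKY_one` (`Δ_k(1) =
  (QG₁Q*)⁻¹(1) − a`), `deltaKY_one_v3` (at the v3 letters: `= (QGQ*)⁻¹(1) − a`, FILE 7's `QG1QinvY_one`); Dirichlet faces `secΛY_mul_CkY`, `CkY_mul_secΛY`,
  `CtildeKY` supported in `Λ̃`; ★ `CsDeltaCY_mul_CtildeKY ∕ CtildeKY_mul_CsDeltaCY : (C*Δ_kC)·C̃^{(k)}(Λ) = P_Λ̃ = C̃^{(k)}(Λ)·(C*Δ_kC)` whenever the corner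
  is a unit ((3.158)'s first equality as an identity on `Λ̃`-functions; the unit property away from `U = 1` is [4] Lemma 2.4 + Sect. B, p. 428, NOT
  claimed); `CkY_flat` (at the flat Sect. E letters `C^{(k)} = 0` — the honest guard: content arrives with genuine letters, (M-E1)).
* §5 THE REPRESENTATION: ★ `rhs3185Y x 𝔏 𝔢 U := P_Λ(1 + Dμ)P_Λ · QG̃₂Q* · P_Λ(1 + μ*D*)P_Λ` with FILE 5's GENUINE `Q(U) = QY`, `Q*(U) = QsY` over the
  record's transporter `𝔏.parB` (3.185); `secΛY_mul_rhs3185Y`, `rhs3185Y_mul_secΛY`; ★★ **`givenBy3185Y x 𝔏 𝔢 U : Prop := CkY x 𝔏 𝔢 U = rhs3185Y x 𝔏 𝔢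
  U`** — «C^{(k)}(Λ) is given by the formula (3.185)», THE PINNED SLOT; `givenBy3185Y_flat` (at the flat letters both sides
  are `0`, so the flat pin holds — recorded as the vacuity guard, not as content).
* §6 ★ `RWLettersEY 𝔸 G x` — a walk-expansion letter for the kernel of `C^{(k)}(Λ)` (r1's `B9.RWKernelExpansion` over the member's geometry ∕ backgrounds
  + the two `O(1)` constants of the term bound); ★★ **`hasRWExpCY x 𝔴 U δ₀`** := `𝔴.EC.Converges U ∧ ∀ ω, ∀ y y′ ∈ Λ, LocDep U ω ∧ |kterm U ω y y′| ≤
  walkFactor C c M δ₀ |ω| d(ω, y, y′)` — Thm 3.9's (3.99) shape at the unit lattice (scale prefactors `(Lᵏη)^{…} = 1`), THE PINNED SLOT; `rwLettersEY_flat`,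
  `hasRWExpCY_flat` (guard).
* §7 ★★ `operatorLayerYSectE 𝔸 G x ops 𝔏 𝔢 𝔴` — the layer `ops` with `Ck := siteKernelOfOp … (CkY x 𝔏 𝔢) id id` (kernel `|C^{(k)}(Λ; U; y, y′)| := sup_E
  ‖(C^{(k)}(Λ; U)(δ_{y′} ⊗ E))(y)‖` at the index bonds, FILE 1's reading), `GivenBy3185 := givenBy3185Y x 𝔏 𝔢`, `HasRWExpC := hasRWExpCY x 𝔴`; twenty
  `rfl` field lemmas (`operatorLayerYSectE_Gp … _QG1Qinv`: unchanged; `_Ck ∕ _GivenBy3185 ∕ _HasRWExpC`: the pins); `operatorLayerYSectE_Ck_ker`.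
* §8 record level (`𝔸 = M_N(ℂ)`, `G = SU(N)`): `SectEY ∕ RWEY` (+ flats); ★ `opsYSectE N θ M⋆ ops 𝔏 𝔢 𝔴` (generic base layer); ★★ `opsYOfRecordE N θ M⋆
  𝔯 𝔢 𝔴 𝔈 := opsYSectE N θ M⋆ (opsYOfRecordDE N θ M⋆ 𝔯 𝔈) (lettersYOfRecordDE N θ M⋆ 𝔯) 𝔢 𝔴` (def-Y's v3 instance updated: row 24 genuine reading,
  `P349` still flat); `opsYOfRecordE_apply`, `_Ck ∕ _GivenBy3185 ∕ _HasRWExpC ∕ _Ck_ker` (row 24's three readings at the instance, `rfl`), `_GA ∕ _Gp ∕ _Cinv ∕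
  _Kdiff ∕ _sectD ∕ _P349 ∕ _QGQinv_QG1Qinv ∕ _exps` (the other rows' letters ARE `opsYOfRecordDE`'s, `rfl`), `Y9OfRecord_opsYOfRecordE`, `_Ck_ker_flat`.
* §8b ★★★ **`opsYOfRecordES N θ M⋆ 𝔯 𝔢 𝔴 𝔈 := opsYSectE N θ M⋆ (opsYS349OfRecordDE N θ M⋆ 𝔯 𝔈) (lettersYOfRecordDE N θ M⋆ 𝔯) 𝔢 𝔴` = THE INSTANCE OF
  RECORD FOR THE N06 CERTIFICATE**: n06-i's `opsYS349OfRecordDE` (v3 + the GENUINE site-sector (3.49) reading `p349SiteY` in `P349`, `B9Ineq349SiteReading`)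
  with the Sect. E update — rows 24 AND 25 read genuine letters, every other field `opsYOfRecordDE`'s; `opsYOfRecordES_apply ∕ _Ck ∕ _Ck_ker ∕ _GivenBy3185 ∕
  _HasRWExpC ∕ _P349 ∕ _letters ∕ _exps ∕ _row24_eq_opsYOfRecordE ∕ _Ck_ker_flat`, `Y9OfRecord_opsYOfRecordES` (all `rfl` but the flat guard).
* §8c ★★ `t315_opsYOfRecordES_iff` (`Iff.rfl`): ROW 24's face `B9.Thm315FullPrinted c35Y geo9Y bg9Y (·.Ck) inΛY unitDistY (·.GivenBy3185) (·.HasRWExpC)` AT THE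
  INSTANCE OF RECORD unfolds to the printed Theorem 3.15 about the kernel of `CkY` over the letters of record with the two pinned slots — the NAMED binder
  the N06 certificate displays; `t315_opsYOfRecordES_flat` — at the FLAT `sectEY_flat ∕ rwEY_flat` the face holds OUTRIGHT (the honesty guard: content
  enters exactly with genuine Sect. E letters).

MODEL ∕ DECLARED READINGS.  (M1)–(M6) as in `Node00.OpsYDeltaA` ∕ `Node00.OpsYSectDE` (fibre any complete normed `ℂ`-algebra; trace-pairing transposes,
no inner product on `𝔸`; inverses are `Ring.inverse` in `Module.End ℂ`, genuine wherever the operator is a unit — for `C*Δ_kC` this is the positivity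
«lower bound γ₀ > 0 independent of k and U», p. 428, [4] Lemma 2.4 at `U = 1` + Sect. B, NOT claimed).  (M-E1) THE RESIDUAL SECT. E LETTERS.  Print
builds `C` from the next-level block structure `Ω_{k+1} = B^k(Λ)` (blocks `B(y)`, `y ∈ Λ′`, axial-gauge trees `Ax(y)`, the bonds `b₀(c)`) and the covariant
one-step averaging `Q₁ = Q(V)`, `V = U_k` = [5]'s k-fold NON-LINEAR average of `U`; `μ(B)` (3.169) and `D = D_V` from the same `V`; `D̃⁽²⁾` is not even
displayed («a quadratic polynomial in B with properties similar to C⁽²⁾»); `G̃₂` is the covariance of the Gaussian (3.183) whose form contains `H̃′`,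
`C̃′^{(k)}(Λ)`, `λ̃(A)` (3.184).  None of `U_k`, `C⁽²⁾`, `J`, `Ω_{k+1}`'s axial gauge is an object of NODE 00's tree (cf. FILE 7 (M6) for `Δ⁽²⁾`), so these
nine objects are carried as ONE parameter record per member (`SectELettersY`, family `SectEY`), each field documented by its printed equation, with the
one printed `U = 1` clause that is an identity of the letter alone (`D2J 1 = 0`).  What IS genuine here: the carrier (functions on the bonds of `Λ`,
Dirichlet outside), the algebra (3.156)–(3.158) assembling `C^{(k)}(Λ; U)` from `(QG₁Q*)⁻¹(U)`, `a`, and the letters, the sector inverse, the (3.185)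
assembly over the genuine `Q(U), Q*(U)`, and the MEANING of the two Thm 3.15 slots.  The construction of a `SectELettersY` of record from (3.157), (3.169),
(3.186) is the successor brick (one more file on this one; it needs the `(k+1)`-block geometry on `MemberY` and a typed `U_k`).  (M-E2) SECTOR INVERSE.
`C*Δ_kC` acts on functions on `Λ̃`; on NODE 00's total carrier `IBondY → 𝔸` it is the `Λ̃`-corner of an operator, never a unit of the whole algebra.
`secInvY S T = P·(PTP + (1 − P))⁻¹·P` is the inverse of the corner `PTP` on `P`-supported functions extended by `0` (`corner_mul_secInvY`), with no
subtype carrier — so `C̃^{(k)}(Λ)` and `C^{(k)}(Λ)` are endomorphisms of the one carrier all rows read.  (M-E3) `y, y′ ∈ Λ` = `inΛY` (MODULE 4): top-level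
index bonds with base point in the member's `Λ`; (3.187)'s `|y − y′|` = `unitDistY`; the kernel reading is FILE 1's `siteKernelOfOp … id id` (as for
`(QGQ*)⁻¹`, `(QG₁Q*)⁻¹`).  (M-E4) dag-ref-E's J2 datum (READ-17, 2026-08-27): in FILE 1's Hölder functional `holderQB` the diagonal pair `x = x′` is
admissible with Mathlib's junk weight `0^{−α} = 0` (`α ≠ 0`), so print's «x ≠ x′» of (3.40) is realised by a junk value; nothing in this file reads a
Hölder functional (the Thm 3.15 row reads a kernel), recorded here for the lineage's readers.
HONEST SCOPE.  Exact finite-dimensional lattice algebra realising the printed FORMULAS (3.156)–(3.158), (3.185) as functions of `U` on NODE 00's carriers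
over located residual letters, and the two Thm 3.15 predicates given their printed meaning; no inequality of the paper (Thm 3.15's bound (3.187), the
expansion's convergence, the positivity of `C*Δ_kC` are hypotheses of the N06 knit, now readable at a letter with the printed carrier and definition).
At the flat letters `sectELettersY_flat` the kernel is `0` again (`CkY_flat`) — the row is non-vacuous exactly for genuine Sect. E letters.  The walk
letter `𝔴 : RWLettersEY` is, as in r1's `Thm39Printed` ∕ `Thm315FullPrinted`, an abstract `RWKernelExpansion` («the expansion of the operator» by
declaration: its `Converges ∕ kterm` are free fields); the operator-level identity `C^{(k)}(Λ; U) = Σ_ω T_ω(U)` in dag-n06-m's `ExpansionReads` currency on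
the index-bond carrier is NOT typed here (located: (O2″), with the Sect. E letters of record (O2′)).  NOT summit
progress; NOT continuum ∕ OS ∕ mass gap ∕ Clay.  Consumers: dag-n06-d (certificate at `ops := opsYOfRecordES …`: row 24 displayed as `Thm315FullPrinted` of
the genuine reading with the pinned slots, row 25 n06-i's `s349` face, rows ≠ 24, 25 transported from `opsYOfRecordDE` by the `rfl` lemmas), dag-n06-m
(rows 22–24 successor: `t315` at the E instance), dag-n06-i (its `opsYS349OfRecordDE` is the base layer of §8b), dag-ref-E ∕ ref-H.  Filed by the pub-ymgap
def-Y owner lineage (`pub-ymgap-node00-def-Y`, gen 4); a NEW file; nothing landed is modified; imports `B9Ineq349SiteReading` (dag-n06-i, landed; it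
imports `Node00.OpsYSectDE`) — nothing of either is restated.  Net new unproved facts: 0.
-/

noncomputable section

namespace Literature.MathematicalPhysics.QuantumFieldTheory.Balaban1983to89.Node00

open B6KLevelCensusIndexV1 (KIdx)
open B9PinMembersKLevelV1 (MemberY geo9Y bg9Y geo9Y_M)
open B9PinCarriersKLevelV1 (OperatorLayerY carriersY)
open B9PinGeometryKLevelV1 (inΛY unitDistY c35Y)
open B7Prop2SpecialUnitary (specialUnitaryUnits)
open B9Eq3132SectDLetters (QGQinvY)
open B9Ineq349SiteReading (p349SiteY opsYS349OfRecordDE)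
open scoped Matrix

variable {d ℓ : ℕ} {hd : 1 ≤ d + 1} {hL : Odd (ℓ + 1) ∧ 1 < ℓ + 1} {b₀ b₁ : ℝ} {Mstar : ℕ}

/-! ## §1 Sectors: restriction to a set of lattice points, and the inverse on a sector -/

section Sector

variable (𝔸 : Type) [NormedRing 𝔸] [NormedAlgebra ℂ 𝔸]

open Classical in
/-- **restriction to the sector `S`** (extension by zero off `S`): `(P_S f)(z) = f(z)` if `z ∈ S`, `0` otherwise — the Dirichlet conditions «B = 0 on Λᶜ»
of p. 428 as a `ℂ`-linear map of `𝔸`-valued lattice functions. [cite: Balaban1985BackgroundPropagators, p.427 («Dirichlet boundary conditions outside some domain Λ»), p.428 («B = 0 on Λᶜ»)] -/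
def secY {X : Type} (S : X → Prop) : Module.End ℂ (X → 𝔸) where
  toFun f z := if S z then f z else 0
  map_add' f g := by
    funext z
    by_cases h : S z <;> simp [h]
  map_smul' c f := by
    funext z
    by_cases h : S z <;> simp [h]

variable {𝔸}

/-- on the sector the restriction is the identity. [cite: Balaban1985BackgroundPropagators, p.428 («B = 0 on Λᶜ»), bookkeeping] -/
theorem secY_apply_of {X : Type} {S : X → Prop} {z : X} (h : S z) (f : X → 𝔸) : secY 𝔸 S f z = f z := by
  simp only [secY, LinearMap.coe_mk, AddHom.coe_mk]
  exact if_pos h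

/-- off the sector the restriction vanishes. [cite: Balaban1985BackgroundPropagators, p.428 («B = 0 on Λᶜ»), bookkeeping] -/
theorem secY_apply_of_not {X : Type} {S : X → Prop} {z : X} (h : ¬ S z) (f : X → 𝔸) : secY 𝔸 S f z = 0 := by
  simp only [secY, LinearMap.coe_mk, AddHom.coe_mk]
  exact if_neg h

/-- `P_T P_S = P_S` for `S ⊂ T`. [cite: Balaban1985BackgroundPropagators, p.428 (Λ̃ ⊂ Λ), bookkeeping] -/
theorem secY_mul_secY_of_imp {X : Type} {S T : X → Prop} (h : ∀ z, S z → T z) : secY 𝔸 T * secY 𝔸 S = secY 𝔸 S := by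
  ext f z
  rw [Module.End.mul_apply]
  by_cases hz : S z
  · rw [secY_apply_of (h z hz), secY_apply_of hz]
  · rw [secY_apply_of_not hz]
    by_cases ht : T z
    · rw [secY_apply_of ht, secY_apply_of_not hz]
    · rw [secY_apply_of_not ht]

/-- `P_S P_T = P_S` for `S ⊂ T`. [cite: Balaban1985BackgroundPropagators, p.428 (Λ̃ ⊂ Λ), bookkeeping] -/
theorem secY_mul_secY_of_imp' {X : Type} {S T : X → Prop} (h : ∀ z, S z → T z) : secY 𝔸 S * secY 𝔸 T = secY 𝔸 S := by
  ext f z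
  rw [Module.End.mul_apply]
  by_cases hz : S z
  · rw [secY_apply_of hz, secY_apply_of hz, secY_apply_of (h z hz)]
  · rw [secY_apply_of_not hz, secY_apply_of_not hz]

/-- `P_S² = P_S`. [cite: Balaban1985BackgroundPropagators, p.428, bookkeeping] -/
theorem secY_idem {X : Type} (S : X → Prop) : secY 𝔸 S * secY 𝔸 S = secY 𝔸 S := secY_mul_secY_of_imp fun _ h => h

/-- `a P_S P_S = a P_S`. [cite: Balaban1985BackgroundPropagators, p.428, bookkeeping] -/
theorem mul_secY_mul_secY {X : Type} (S : X → Prop) (a : Module.End ℂ (X → 𝔸)) : a * secY 𝔸 S * secY 𝔸 S = a * secY 𝔸 S := by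
  rw [mul_assoc, secY_idem]

variable (𝔸)

/-- **the complemented corner** `P_S T P_S + (1 − P_S)` of an operator `T`: block-diagonal with respect to `S`-supported ⊕ `Sᶜ`-supported functions,
with blocks (the `S`-corner of `T`, the identity) — a unit of the whole algebra exactly when the corner is invertible on the `S`-supported functions.
[cite: Balaban1985BackgroundPropagators, (3.158) p.428 ((C*Δ_kC)⁻¹ on the functions on Λ̃), dictionary] -/
def secCornerY {X : Type} (S : X → Prop) (T : Module.End ℂ (X → 𝔸)) : Module.End ℂ (X → 𝔸) := secY 𝔸 S * T * secY 𝔸 S + (1 - secY 𝔸 S)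

/-- ★ **the inverse of `T` on the sector `S`, extended by zero**: `P_S (P_S T P_S + (1 − P_S))⁻¹ P_S` (`Ring.inverse`; `0` if the corner is not a unit).
[cite: Balaban1985BackgroundPropagators, (3.158) p.428 ((C*Δ_kC)⁻¹ = C̃^{(k)}(Λ)), dictionary] -/
def secInvY {X : Type} (S : X → Prop) (T : Module.End ℂ (X → 𝔸)) : Module.End ℂ (X → 𝔸) :=
  secY 𝔸 S * Ring.inverse (secCornerY 𝔸 S T) * secY 𝔸 S

variable {𝔸}

/-- `P_S K = P_S T P_S`. [cite: Balaban1985BackgroundPropagators, (3.158) p.428, bookkeeping] -/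
theorem secY_mul_secCornerY {X : Type} (S : X → Prop) (T : Module.End ℂ (X → 𝔸)) : secY 𝔸 S * secCornerY 𝔸 S T = secY 𝔸 S * T * secY 𝔸 S := by
  rw [secCornerY, mul_add, ← mul_assoc, ← mul_assoc, secY_idem, mul_sub, mul_one, secY_idem, sub_self, add_zero]

/-- `K P_S = P_S T P_S`. [cite: Balaban1985BackgroundPropagators, (3.158) p.428, bookkeeping] -/
theorem secCornerY_mul_secY {X : Type} (S : X → Prop) (T : Module.End ℂ (X → 𝔸)) : secCornerY 𝔸 S T * secY 𝔸 S = secY 𝔸 S * T * secY 𝔸 S := by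
  rw [secCornerY, add_mul, mul_secY_mul_secY, sub_mul, one_mul, secY_idem, sub_self, add_zero]

/-- `P_S` commutes with the corner. [cite: Balaban1985BackgroundPropagators, (3.158) p.428, bookkeeping] -/
theorem secY_mul_secCornerY_comm {X : Type} (S : X → Prop) (T : Module.End ℂ (X → 𝔸)) : secY 𝔸 S * secCornerY 𝔸 S T = secCornerY 𝔸 S T * secY 𝔸 S := by
  rw [secY_mul_secCornerY, secCornerY_mul_secY]

/-- the sector inverse is supported in `S` (left). [cite: Balaban1985BackgroundPropagators, (3.158) p.428, bookkeeping] -/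
theorem secY_mul_secInvY {X : Type} (S : X → Prop) (T : Module.End ℂ (X → 𝔸)) : secY 𝔸 S * secInvY 𝔸 S T = secInvY 𝔸 S T := by
  rw [secInvY, ← mul_assoc, ← mul_assoc, secY_idem]

/-- the sector inverse is supported in `S` (right). [cite: Balaban1985BackgroundPropagators, (3.158) p.428, bookkeeping] -/
theorem secInvY_mul_secY {X : Type} (S : X → Prop) (T : Module.End ℂ (X → 𝔸)) : secInvY 𝔸 S T * secY 𝔸 S = secInvY 𝔸 S T := by
  rw [secInvY, mul_secY_mul_secY]

/-- `P_S` commutes with the inverse of the corner (whenever the corner is a unit). [cite: Balaban1985BackgroundPropagators, (3.158) p.428, bookkeeping] -/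
theorem secY_mul_inverse_secCornerY_comm {X : Type} (S : X → Prop) (T : Module.End ℂ (X → 𝔸)) (h : IsUnit (secCornerY 𝔸 S T)) :
    secY 𝔸 S * Ring.inverse (secCornerY 𝔸 S T) = Ring.inverse (secCornerY 𝔸 S T) * secY 𝔸 S := by
  calc secY 𝔸 S * Ring.inverse (secCornerY 𝔸 S T)
        = Ring.inverse (secCornerY 𝔸 S T) * secCornerY 𝔸 S T * (secY 𝔸 S * Ring.inverse (secCornerY 𝔸 S T)) := by
          rw [Ring.inverse_mul_cancel _ h, one_mul]
    _ = Ring.inverse (secCornerY 𝔸 S T) * (secCornerY 𝔸 S T * secY 𝔸 S) * Ring.inverse (secCornerY 𝔸 S T) := by simp only [mul_assoc]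
    _ = Ring.inverse (secCornerY 𝔸 S T) * (secY 𝔸 S * secCornerY 𝔸 S T) * Ring.inverse (secCornerY 𝔸 S T) := by rw [secY_mul_secCornerY_comm]
    _ = Ring.inverse (secCornerY 𝔸 S T) * secY 𝔸 S * (secCornerY 𝔸 S T * Ring.inverse (secCornerY 𝔸 S T)) := by simp only [mul_assoc]
    _ = Ring.inverse (secCornerY 𝔸 S T) * secY 𝔸 S := by rw [Ring.mul_inverse_cancel _ h, mul_one]

/-- ★ **the sector inverse inverts the corner on the sector (right)**: `(P_S T P_S)·secInvY = P_S` whenever the corner is a unit.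
[cite: Balaban1985BackgroundPropagators, (3.158) p.428 ((C*Δ_kC)(C*Δ_kC)⁻¹ = I on the functions on Λ̃), bookkeeping] -/
theorem corner_mul_secInvY {X : Type} (S : X → Prop) (T : Module.End ℂ (X → 𝔸)) (h : IsUnit (secCornerY 𝔸 S T)) :
    secY 𝔸 S * T * secY 𝔸 S * secInvY 𝔸 S T = secY 𝔸 S := by
  rw [← secCornerY_mul_secY, secInvY]
  calc secCornerY 𝔸 S T * secY 𝔸 S * (secY 𝔸 S * Ring.inverse (secCornerY 𝔸 S T) * secY 𝔸 S)
        = secCornerY 𝔸 S T * (secY 𝔸 S * secY 𝔸 S) * Ring.inverse (secCornerY 𝔸 S T) * secY 𝔸 S := by simp only [mul_assoc]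
    _ = secCornerY 𝔸 S T * (secY 𝔸 S * Ring.inverse (secCornerY 𝔸 S T)) * secY 𝔸 S := by rw [secY_idem]; simp only [mul_assoc]
    _ = secCornerY 𝔸 S T * Ring.inverse (secCornerY 𝔸 S T) * (secY 𝔸 S * secY 𝔸 S) := by
          rw [secY_mul_inverse_secCornerY_comm S T h]; simp only [mul_assoc]
    _ = secY 𝔸 S := by rw [Ring.mul_inverse_cancel _ h, one_mul, secY_idem]

/-- ★ **… and on the left**: `secInvY·(P_S T P_S) = P_S` whenever the corner is a unit. [cite: Balaban1985BackgroundPropagators, (3.158) p.428, bookkeeping] -/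
theorem secInvY_mul_corner {X : Type} (S : X → Prop) (T : Module.End ℂ (X → 𝔸)) (h : IsUnit (secCornerY 𝔸 S T)) :
    secInvY 𝔸 S T * (secY 𝔸 S * T * secY 𝔸 S) = secY 𝔸 S := by
  rw [← secY_mul_secCornerY, secInvY]
  calc secY 𝔸 S * Ring.inverse (secCornerY 𝔸 S T) * secY 𝔸 S * (secY 𝔸 S * secCornerY 𝔸 S T)
        = secY 𝔸 S * Ring.inverse (secCornerY 𝔸 S T) * (secY 𝔸 S * secY 𝔸 S) * secCornerY 𝔸 S T := by simp only [mul_assoc]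
    _ = secY 𝔸 S * (Ring.inverse (secCornerY 𝔸 S T) * secY 𝔸 S) * secCornerY 𝔸 S T := by rw [secY_idem]; simp only [mul_assoc]
    _ = secY 𝔸 S * secY 𝔸 S * (Ring.inverse (secCornerY 𝔸 S T) * secCornerY 𝔸 S T) := by
          rw [← secY_mul_inverse_secCornerY_comm S T h]; simp only [mul_assoc]
    _ = secY 𝔸 S := by rw [Ring.inverse_mul_cancel _ h, mul_one, secY_idem]

end Sector

variable {𝔸 : Type} [NormedRing 𝔸] [NormedAlgebra ℂ 𝔸] [CompleteSpace 𝔸]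

/-! ## §2 The carrier: letters on index-bond functions, restriction to the bonds of `Λ` -/

/-- a letter on `𝔸`-valued INDEX-BOND functions depending on `U` (`(QGQ*)⁻¹`, `(QG₁Q*)⁻¹`, `Δ_k`, `C`, `C̃^{(k)}(Λ)`, `C^{(k)}(Λ)`).
[cite: Balaban1985BackgroundPropagators, (3.132) p.422, (3.156)–(3.158) p.428] -/
abbrev IBondOpY (𝔸 : Type) [NormedRing 𝔸] [NormedAlgebra ℂ 𝔸] [CompleteSpace 𝔸] (i : KIdx d ℓ hd hL b₀ b₁) : Type :=
  CfgY 𝔸 i → (IBondY i → 𝔸) →ₗ[ℂ] (IBondY i → 𝔸)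

section Carrier

variable (𝔸)

/-- **restriction to the bonds of `Λ`** (`P_Λ`): the top-level index bonds with base point in the member's `Λ` (MODULE 4's `inΛY`, (M-E3)) — the carrier
of `C^{(k)}(Λ)` with its Dirichlet conditions «B = 0 on Λᶜ». [cite: Balaban1985BackgroundPropagators, p.427 («g … defined at bonds of Λ»), p.428 («B = 0 on Λᶜ»), Thm 3.15 p.432 («y, y′ ∈ Λ»)] -/
def secΛY (x : MemberY d ℓ hd hL b₀ b₁ Mstar) : Module.End ℂ (IBondY x.toKIdx → 𝔸) := secY 𝔸 (inΛY x)

variable {𝔸}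

omit [CompleteSpace 𝔸] in
/-- `P_Λ² = P_Λ`. [cite: Balaban1985BackgroundPropagators, p.428, bookkeeping] -/
theorem secΛY_idem (x : MemberY d ℓ hd hL b₀ b₁ Mstar) : secΛY 𝔸 x * secΛY 𝔸 x = secΛY 𝔸 x := secY_idem _

omit [CompleteSpace 𝔸] in
/-- `a P_Λ P_Λ = a P_Λ`. [cite: Balaban1985BackgroundPropagators, p.428, bookkeeping] -/
theorem mul_secΛY_mul_secΛY (x : MemberY d ℓ hd hL b₀ b₁ Mstar) (a : Module.End ℂ (IBondY x.toKIdx → 𝔸)) :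
    a * secΛY 𝔸 x * secΛY 𝔸 x = a * secΛY 𝔸 x := mul_secY_mul_secY _ a

end Carrier

/-! ## §3 The residual Sect. E letters at a member -/

section Letters

variable (𝔸)

/-- ★ **THE RESIDUAL SECT. E LETTERS AT A MEMBER** ((M-E1); PARAMETERS, each named by its printed equation): `LamT` = the bond set `Λ̃ ⊂ Λ` of (3.157)
(`Λ` minus the axial-gauge trees `Ax(y)` and the bonds `b₀(c) = B(c) ∩ c`); `D2J U` = the operator of the form `B ↦ 2⟨H₁D̃⁽²⁾(B), J⟩` in (3.156), with
its `U = 1` clause (`J = D*η⁻²Im ∂U = 0` at `U = 1`, p. 419); `elimC U` = the parametrisation `C` of (3.157) («an identity operator on almost all bonds,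
except the bonds b₀ …, (CB̃)(b₀) … a solution of (QB)(c) = 0»; depends on `U` through `Q₁ = Q(V)`, `V = U_k`), `elimCt U` = `C*`; `mu U` = (3.169)'s
`μ(B)` (a function on the unit-lattice sites `x ∈ B(y)`, carried on the fine sites), `muT U` = `μ*`; `Dbar U` = the unit-lattice covariant derivative
`D = D_V` of (3.168)∕(3.185) (site functions ↦ bond functions), `DbarT U` = `D*`; `Gt2 U` = the covariance `G̃₂` of (3.183)∕(3.186).
[cite: Balaban1985BackgroundPropagators, (3.156)–(3.157) p.428, (3.168)–(3.169) p.430, (3.183)–(3.186) p.432, (3.117) p.419 (J)] -/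
structure SectELettersY (x : MemberY d ℓ hd hL b₀ b₁ Mstar) where
  LamT : IBondY x.toKIdx → Prop
  LamT_inΛ : ∀ b, LamT b → inΛY x b
  D2J : IBondOpY 𝔸 x.toKIdx
  D2J_one : D2J (fun _ _ => 1) = 0
  elimC : IBondOpY 𝔸 x.toKIdx
  elimCt : IBondOpY 𝔸 x.toKIdx
  mu : CfgY 𝔸 x.toKIdx → (IBondY x.toKIdx → 𝔸) →ₗ[ℂ] (SiteY x.toKIdx → 𝔸)
  muT : CfgY 𝔸 x.toKIdx → (SiteY x.toKIdx → 𝔸) →ₗ[ℂ] (IBondY x.toKIdx → 𝔸)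
  Dbar : CfgY 𝔸 x.toKIdx → (SiteY x.toKIdx → 𝔸) →ₗ[ℂ] (IBondY x.toKIdx → 𝔸)
  DbarT : CfgY 𝔸 x.toKIdx → (IBondY x.toKIdx → 𝔸) →ₗ[ℂ] (SiteY x.toKIdx → 𝔸)
  Gt2 : BondOpY 𝔸 x.toKIdx

/-- the flat Sect. E letters (`Λ̃ := Λ`, every operator `0`) — inhabitation only; NOT the printed objects (`CkY_flat`). [cite: Balaban1985BackgroundPropagators, (3.156)–(3.158) p.428, bookkeeping] -/
def sectELettersY_flat (x : MemberY d ℓ hd hL b₀ b₁ Mstar) : SectELettersY 𝔸 x where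
  LamT := inΛY x
  LamT_inΛ := fun _ h => h
  D2J := fun _ => 0
  D2J_one := rfl
  elimC := fun _ => 0
  elimCt := fun _ => 0
  mu := fun _ => 0
  muT := fun _ => 0
  Dbar := fun _ => 0
  DbarT := fun _ => 0
  Gt2 := fun _ => 0

end Letters

/-! ## §4 The definition (3.156)–(3.158): `Δ_k`, `C̃^{(k)}(Λ) = (C*Δ_kC)⁻¹`, `C^{(k)}(Λ) = C C̃^{(k)}(Λ) C*` -/

section Definition

variable (x : MemberY d ℓ hd hL b₀ b₁ Mstar) (𝔏 : CovLettersY 𝔸 x) (𝔢 : SectELettersY 𝔸 x)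

/-- ★ **(3.156)** `Δ_k(U) := (QG₁Q*)⁻¹(U) − a − D2J(U)` — the operator of the form `⟨B, (QG₁Q*)⁻¹B⟩ − a⟨B, B⟩ − 2⟨H₁D̃⁽²⁾(B), J⟩ = ⟨B, Δ_kB⟩`, over the
letter `(QG₁Q*)⁻¹` of the record `𝔏` (at the v3 letters: FILE 7's `QG1QinvY`, (3.132)) and FILE 5's weight operator `a = aY`.
[cite: Balaban1985BackgroundPropagators, (3.156) p.428] -/
def deltaKY : IBondOpY 𝔸 x.toKIdx := fun U => 𝔏.QG1Qinv U - aY x.toKIdx - 𝔢.D2J U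

/-- **the parametrisation `C` read from the `Λ̃`-functions to the `Λ`-functions**: `P_Λ C(U) P_Λ̃` (Dirichlet outside `Λ` by construction).
[cite: Balaban1985BackgroundPropagators, (3.157) p.428 («B = CB̃»)] -/
def elimCΛY : IBondOpY 𝔸 x.toKIdx := fun U => secΛY 𝔸 x * 𝔢.elimC U * secY 𝔸 𝔢.LamT

/-- **its adjoint `C*` read from the `Λ`-functions to the `Λ̃`-functions**: `P_Λ̃ C*(U) P_Λ`. [cite: Balaban1985BackgroundPropagators, (3.157) p.428 («C*g»)] -/
def elimCtΛY : IBondOpY 𝔸 x.toKIdx := fun U => secY 𝔸 𝔢.LamT * 𝔢.elimCt U * secΛY 𝔸 x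

/-- **(3.157)'s operator `C*Δ_kC`** on the `Λ̃`-functions. [cite: Balaban1985BackgroundPropagators, (3.157) p.428] -/
def CsDeltaCY : IBondOpY 𝔸 x.toKIdx := fun U => elimCtΛY x 𝔢 U * deltaKY x 𝔏 𝔢 U * elimCΛY x 𝔢 U

/-- ★ **(3.158), first equality: `C̃^{(k)}(Λ; U) := (C*Δ_kC)⁻¹`** — the inverse ON THE `Λ̃`-FUNCTIONS, extended by zero ((M-E2): the sector inverse
`secInvY`; genuine wherever the corner is a unit, which is the positivity of `C*Δ_kC`, p. 428, not claimed). [cite: Balaban1985BackgroundPropagators, (3.158) p.428] -/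
def CtildeKY : IBondOpY 𝔸 x.toKIdx := fun U => secInvY 𝔸 𝔢.LamT (CsDeltaCY x 𝔏 𝔢 U)

/-- ★★ **THE UNIT-LATTICE PROPAGATOR `C^{(k)}(Λ; U) := C C̃^{(k)}(Λ) C*`** ((3.158), second equality) — an operator on the `𝔸`-valued functions on the
bonds of `Λ` (top-level index bonds, Dirichlet outside `Λ`), as a function of the background `U`, over the record's letter `(QG₁Q*)⁻¹(U)`, the weight
`a`, and the residual Sect. E letters. [cite: Balaban1985BackgroundPropagators, (3.158) p.428, (3.155)–(3.157) pp.427–428, Thm 3.15 p.432] -/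
def CkY : IBondOpY 𝔸 x.toKIdx := fun U => elimCΛY x 𝔢 U * CtildeKY x 𝔏 𝔢 U * elimCtΛY x 𝔢 U

variable {x 𝔏 𝔢}

/-- `Δ_k` unfolded. [cite: Balaban1985BackgroundPropagators, (3.156) p.428, bookkeeping] -/
theorem deltaKY_apply (U : CfgY 𝔸 x.toKIdx) : deltaKY x 𝔏 𝔢 U = 𝔏.QG1Qinv U - aY x.toKIdx - 𝔢.D2J U := rfl

/-- at `U = 1`: `Δ_k(1) = (QG₁Q*)⁻¹(1) − a` (the `J`-term drops by the letter's printed clause). [cite: Balaban1985BackgroundPropagators, (3.156) p.428, (3.117) p.419 (J = 0 at U = 1)] -/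
theorem deltaKY_one : deltaKY x 𝔏 𝔢 (fun _ _ => 1) = 𝔏.QG1Qinv (fun _ _ => 1) - aY x.toKIdx := by
  rw [deltaKY_apply, 𝔢.D2J_one, sub_zero]

variable (x) in
/-- at `U = 1` AND at def-Y's v3 letters: `Δ_k(1) = (QGQ*)⁻¹(1) − a` with n06-i's GENUINE `(QGQ*)⁻¹` of (3.132) (FILE 7's `QG1QinvY_one`: `G₁(1) = G(1)`
since `Δ⁽²⁾(1) = 0`). [cite: Balaban1985BackgroundPropagators, (3.156) p.428, (3.132) p.422, Cor. 3.5 p.407 (U = 1)] -/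
theorem deltaKY_one_v3 (𝔯 : ResLettersY 𝔸 x) (𝔢 : SectELettersY 𝔸 x) :
    deltaKY x (covLettersY_v3 𝔸 x 𝔯) 𝔢 (fun _ _ => 1) =
      QGQinvY x.toKIdx (parSY x.toKIdx) (parBY x.toKIdx) (GpY x.toKIdx (parSY x.toKIdx)) (fun _ _ => 1) - aY x.toKIdx := by
  rw [deltaKY_one, covLettersY_v3_QG1Qinv, QG1QinvY_one _ _ _ _ 𝔯.Δ2_one]

/-- `C^{(k)}(Λ)` unfolded: `C C̃^{(k)}(Λ) C*`. [cite: Balaban1985BackgroundPropagators, (3.158) p.428, bookkeeping] -/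
theorem CkY_apply (U : CfgY 𝔸 x.toKIdx) : CkY x 𝔏 𝔢 U = elimCΛY x 𝔢 U * CtildeKY x 𝔏 𝔢 U * elimCtΛY x 𝔢 U := rfl

/-- Dirichlet (left): `P_Λ C^{(k)}(Λ; U) = C^{(k)}(Λ; U)` — the range consists of functions on the bonds of `Λ`. [cite: Balaban1985BackgroundPropagators, p.427 (Dirichlet outside Λ), (3.158) p.428] -/
theorem secΛY_mul_CkY (U : CfgY 𝔸 x.toKIdx) : secΛY 𝔸 x * CkY x 𝔏 𝔢 U = CkY x 𝔏 𝔢 U := by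
  simp only [CkY, elimCΛY, ← mul_assoc, secΛY_idem]

/-- Dirichlet (right): `C^{(k)}(Λ; U) P_Λ = C^{(k)}(Λ; U)` — it reads its argument on the bonds of `Λ` only. [cite: Balaban1985BackgroundPropagators, p.427 (Dirichlet outside Λ), (3.158) p.428] -/
theorem CkY_mul_secΛY (U : CfgY 𝔸 x.toKIdx) : CkY x 𝔏 𝔢 U * secΛY 𝔸 x = CkY x 𝔏 𝔢 U := by
  simp only [CkY, elimCtΛY, ← mul_assoc, mul_secΛY_mul_secΛY]

/-- `C̃^{(k)}(Λ)` is supported in `Λ̃` (left). [cite: Balaban1985BackgroundPropagators, (3.158) p.428 (an operator on the functions on Λ̃)] -/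
theorem secY_mul_CtildeKY (U : CfgY 𝔸 x.toKIdx) : secY 𝔸 𝔢.LamT * CtildeKY x 𝔏 𝔢 U = CtildeKY x 𝔏 𝔢 U := secY_mul_secInvY _ _

/-- `C̃^{(k)}(Λ)` is supported in `Λ̃` (right). [cite: Balaban1985BackgroundPropagators, (3.158) p.428] -/
theorem CtildeKY_mul_secY (U : CfgY 𝔸 x.toKIdx) : CtildeKY x 𝔏 𝔢 U * secY 𝔸 𝔢.LamT = CtildeKY x 𝔏 𝔢 U := secInvY_mul_secY _ _

/-- `C*Δ_kC` is an operator on the `Λ̃`-functions: `P_Λ̃ (C*Δ_kC) P_Λ̃ = C*Δ_kC`. [cite: Balaban1985BackgroundPropagators, (3.157) p.428, bookkeeping] -/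
theorem secY_mul_CsDeltaCY_mul_secY (U : CfgY 𝔸 x.toKIdx) :
    secY 𝔸 𝔢.LamT * CsDeltaCY x 𝔏 𝔢 U * secY 𝔸 𝔢.LamT = CsDeltaCY x 𝔏 𝔢 U := by
  simp only [CsDeltaCY, elimCtΛY, elimCΛY, ← mul_assoc, secY_idem, mul_secY_mul_secY]

/-- ★ **(3.158) as an identity on the `Λ̃`-functions (right inverse)**: `(C*Δ_kC)·C̃^{(k)}(Λ) = P_Λ̃` whenever the `Λ̃`-corner of `C*Δ_kC` is a unit (its
positivity «with a lower bound γ₀ > 0 independent of k and U», p. 428 — [4] Lemma 2.4 at `U = 1`, Sect. B methods in general; NOT claimed here).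
[cite: Balaban1985BackgroundPropagators, (3.158) p.428, p.428 (positivity of C*Δ_kC)] -/
theorem CsDeltaCY_mul_CtildeKY (U : CfgY 𝔸 x.toKIdx) (h : IsUnit (secCornerY 𝔸 𝔢.LamT (CsDeltaCY x 𝔏 𝔢 U))) :
    CsDeltaCY x 𝔏 𝔢 U * CtildeKY x 𝔏 𝔢 U = secY 𝔸 𝔢.LamT := by
  rw [← secY_mul_CsDeltaCY_mul_secY U]
  exact corner_mul_secInvY _ _ h

/-- ★ **… (left inverse)**: `C̃^{(k)}(Λ)·(C*Δ_kC) = P_Λ̃` under the same unit hypothesis. [cite: Balaban1985BackgroundPropagators, (3.158) p.428] -/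
theorem CtildeKY_mul_CsDeltaCY (U : CfgY 𝔸 x.toKIdx) (h : IsUnit (secCornerY 𝔸 𝔢.LamT (CsDeltaCY x 𝔏 𝔢 U))) :
    CtildeKY x 𝔏 𝔢 U * CsDeltaCY x 𝔏 𝔢 U = secY 𝔸 𝔢.LamT := by
  rw [← secY_mul_CsDeltaCY_mul_secY U]
  exact secInvY_mul_corner _ _ h

variable (x 𝔏) in
/-- THE VACUITY GUARD: at the flat Sect. E letters (`C = 0`) the propagator letter is `0` — the Thm 3.15 row is non-vacuous exactly for genuine letters
((M-E1); the record-side `SectELettersY` from (3.157), (3.169), (3.186) is the successor brick). [cite: Balaban1985BackgroundPropagators, (3.158) p.428, bookkeeping] -/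
theorem CkY_flat (U : CfgY 𝔸 x.toKIdx) : CkY x 𝔏 (sectELettersY_flat 𝔸 x) U = 0 := by
  simp only [CkY, elimCΛY, sectELettersY_flat, mul_zero, zero_mul]

end Definition

/-! ## §5 The representation (3.185) and the slot «C^{(k)}(Λ) is given by the formula (3.185)» -/

section Representation

variable (x : MemberY d ℓ hd hL b₀ b₁ Mstar) (𝔏 : CovLettersY 𝔸 x) (𝔢 : SectELettersY 𝔸 x)

/-- ★ **THE RIGHT-HAND SIDE OF (3.185)** `(I + Dμ)QG̃₂Q*(I + μ*D*)` read on the functions on the bonds of `Λ`: `P_Λ(1 + Dμ)P_Λ · Q(U)G̃₂(U)Q*(U) ·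
P_Λ(1 + μ*D*)P_Λ`, with FILE 5's GENUINE covariant averaging `Q(U) = QY`, `Q*(U) = QsY` over the record's transporter `𝔏.parB` and the residual
letters `D, μ, μ*, D*, G̃₂`. [cite: Balaban1985BackgroundPropagators, (3.185) p.432, (3.15)–(3.16) p.393 (Q, Q*)] -/
def rhs3185Y : IBondOpY 𝔸 x.toKIdx := fun U =>
  secΛY 𝔸 x * (1 + 𝔢.Dbar U ∘ₗ 𝔢.mu U) * secΛY 𝔸 x *
    (QY x.toKIdx 𝔏.parB U ∘ₗ 𝔢.Gt2 U ∘ₗ QsY x.toKIdx 𝔏.parB U) *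
    (secΛY 𝔸 x * (1 + 𝔢.muT U ∘ₗ 𝔢.DbarT U) * secΛY 𝔸 x)

/-- ★★ **THE SLOT `GivenBy3185`, PINNED**: «the propagator C^{(k)}(Λ) is given by the formula (3.185)» := the letter `C^{(k)}(Λ; U)` DEFINED by
(3.156)–(3.158) EQUALS the (3.185) expression, as operators on the functions on the bonds of `Λ`. [cite: Balaban1985BackgroundPropagators, Thm 3.15 p.432 («is given by the formula (3.185)»), (3.158) p.428] -/
def givenBy3185Y : CfgY 𝔸 x.toKIdx → Prop := fun U => CkY x 𝔏 𝔢 U = rhs3185Y x 𝔏 𝔢 U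

variable {x 𝔏 𝔢}

/-- the slot unfolded. [cite: Balaban1985BackgroundPropagators, Thm 3.15 p.432, bookkeeping] -/
theorem givenBy3185Y_iff (U : CfgY 𝔸 x.toKIdx) : givenBy3185Y x 𝔏 𝔢 U ↔ CkY x 𝔏 𝔢 U = rhs3185Y x 𝔏 𝔢 U := Iff.rfl

/-- Dirichlet (left) for the (3.185) expression. [cite: Balaban1985BackgroundPropagators, (3.185) p.432, p.427 (functions on the bonds of Λ)] -/
theorem secΛY_mul_rhs3185Y (U : CfgY 𝔸 x.toKIdx) : secΛY 𝔸 x * rhs3185Y x 𝔏 𝔢 U = rhs3185Y x 𝔏 𝔢 U := by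
  simp only [rhs3185Y, ← mul_assoc, secΛY_idem]

/-- Dirichlet (right) for the (3.185) expression. [cite: Balaban1985BackgroundPropagators, (3.185) p.432, p.427] -/
theorem rhs3185Y_mul_secΛY (U : CfgY 𝔸 x.toKIdx) : rhs3185Y x 𝔏 𝔢 U * secΛY 𝔸 x = rhs3185Y x 𝔏 𝔢 U := by
  simp only [rhs3185Y, ← mul_assoc, mul_secΛY_mul_secΛY]

variable (x 𝔏) in
/-- vacuity guard for the slot: at the flat letters both sides of (3.185) are `0`, so the flat pin holds trivially — content arrives with genuine letters.
[cite: Balaban1985BackgroundPropagators, (3.185) p.432, bookkeeping] -/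
theorem givenBy3185Y_flat (U : CfgY 𝔸 x.toKIdx) : givenBy3185Y x 𝔏 (sectELettersY_flat 𝔸 x) U := by
  rw [givenBy3185Y_iff, CkY_flat]
  simp only [rhs3185Y, sectELettersY_flat, LinearMap.comp_zero, LinearMap.zero_comp, mul_zero, zero_mul]

end Representation

/-! ## §6 The slot «a convergent random walk expansion of the type described previously» (Thm 3.9's (3.98)–(3.99) shape for a kernel) -/

section Expansion

variable (𝔸) (G : Subgroup 𝔸ˣ)

/-- ★ **A WALK-EXPANSION LETTER FOR THE KERNEL OF `C^{(k)}(Λ)`** at a member: r1's `B9.RWKernelExpansion` (walks, their lengths and tree-distances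
`d(ω, y, y′)`, the terms of the kernel expansion, their local `U`-dependence, convergence) over the member's geometry ∕ backgrounds, and the two `O(1)`
constants of the (3.99)-type term bound (positive).  A PARAMETER (print obtains the expansion by inserting the Sect. C expansions into (3.185), p. 432).
[cite: Balaban1985BackgroundPropagators, Thm 3.15 p.432 («a convergent random walk expansion of the type described previously»), Thm 3.9 (3.98)–(3.99) p.413] -/
structure RWLettersEY (x : MemberY d ℓ hd hL b₀ b₁ Mstar) where
  EC : B9.RWKernelExpansion (geo9Y x) (bg9Y 𝔸 G x)
  C : ℝ
  c : ℝ
  C_pos : 0 < C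
  c_pos : 0 < c

/-- the flat walk letter (one walk, zero terms, `Converges := True`) — inhabitation only. [cite: Balaban1985BackgroundPropagators, Thm 3.15 p.432, bookkeeping] -/
def rwLettersEY_flat (x : MemberY d ℓ hd hL b₀ b₁ Mstar) : RWLettersEY 𝔸 G x where
  EC := ⟨PUnit, fun _ => 0, fun _ _ _ => 0, fun _ _ _ _ => 0, fun _ _ => True, fun _ => True⟩
  C := 1
  c := 1
  C_pos := one_pos
  c_pos := one_pos

variable {𝔸 G}

/-- ★★ **THE SLOT `HasRWExpC`, PINNED** — «this propagator has a convergent random walk expansion of the type described previously» at `(U, δ₀)` :=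
the expansion letter converges at `U`, and for every walk `ω` and all `y, y′ ∈ Λ` its term depends on `U` locally and obeys the (3.99)-type bound
`|kterm(U; ω; y, y′)| ≤ C(cM^{−½})^{|ω|}M^{−½|ω|}e^{−½δ₀d(ω,y,y′)}` (r1's `walkFactor`; on the unit lattice the scale prefactors `(Lᵏη)^{…}` are `1`).
[cite: Balaban1985BackgroundPropagators, Thm 3.15 p.432, Thm 3.9 (3.98)–(3.99) p.413, (3.94) p.410] -/
def hasRWExpCY {x : MemberY d ℓ hd hL b₀ b₁ Mstar} (𝔴 : RWLettersEY 𝔸 G x) : (bg9Y 𝔸 G x).Cfg → ℝ → Prop := fun U δ₀ =>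
  𝔴.EC.Converges U ∧
    ∀ (ω : 𝔴.EC.Walk) (y y' : (geo9Y x).Site), inΛY x y → inΛY x y' →
      𝔴.EC.LocDep U ω ∧ |𝔴.EC.kterm U ω y y'| ≤ B9.walkFactor 𝔴.C 𝔴.c (geo9Y x).M δ₀ (𝔴.EC.wlen ω) (𝔴.EC.wdist ω y y')

/-- the slot unfolded. [cite: Balaban1985BackgroundPropagators, Thm 3.15 p.432, bookkeeping] -/
theorem hasRWExpCY_iff {x : MemberY d ℓ hd hL b₀ b₁ Mstar} (𝔴 : RWLettersEY 𝔸 G x) (U : (bg9Y 𝔸 G x).Cfg) (δ₀ : ℝ) :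
    hasRWExpCY 𝔴 U δ₀ ↔ 𝔴.EC.Converges U ∧
      ∀ (ω : 𝔴.EC.Walk) (y y' : (geo9Y x).Site), inΛY x y → inΛY x y' →
        𝔴.EC.LocDep U ω ∧ |𝔴.EC.kterm U ω y y'| ≤ B9.walkFactor 𝔴.C 𝔴.c (geo9Y x).M δ₀ (𝔴.EC.wlen ω) (𝔴.EC.wdist ω y y') := Iff.rfl

variable (𝔸 G) in
/-- vacuity guard: the flat walk letter satisfies the slot at every `(U, δ₀)` (its terms are `0`, the walk factor is `≥ 0`).
[cite: Balaban1985BackgroundPropagators, Thm 3.15 p.432, bookkeeping] -/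
theorem hasRWExpCY_flat (x : MemberY d ℓ hd hL b₀ b₁ Mstar) (U : (bg9Y 𝔸 G x).Cfg) (δ₀ : ℝ) : hasRWExpCY (rwLettersEY_flat 𝔸 G x) U δ₀ := by
  refine ⟨trivial, fun ω y y' _ _ => ⟨trivial, ?_⟩⟩
  have hM : (0 : ℝ) ≤ (geo9Y x).M := by rw [geo9Y_M]; positivity
  show |(0 : ℝ)| ≤ B9.walkFactor 1 1 (geo9Y x).M δ₀ 0 0
  rw [abs_zero]
  unfold B9.walkFactor
  positivity

end Expansion

/-! ## §7 The layer update: `Ck`, `GivenBy3185`, `HasRWExpC` at a member -/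

section Layer

variable (𝔸) (G : Subgroup 𝔸ˣ)

/-- ★★ **THE OPERATOR LAYER WITH THE SECT. E LETTER AND THE THM 3.15 SLOTS PINNED**: the base layer `ops` (def-Y's `operatorLayerYOfLetters`, n06-i's
`operatorLayerYS349`, …) with `Ck :=` FILE 1's index-bond kernel reading of `C^{(k)}(Λ; U) = CkY x 𝔏 𝔢` (`|C^{(k)}(Λ; U; y, y′)| := sup_{‖E‖≤1}
‖(C^{(k)}(Λ; U)(δ_{y′} ⊗ E))(y)‖`), `GivenBy3185 := givenBy3185Y x 𝔏 𝔢`, `HasRWExpC := hasRWExpCY 𝔴`; every other field is `ops`'s.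
[cite: Balaban1985BackgroundPropagators, Thm 3.15 (3.185)–(3.187) p.432, (3.158) p.428] -/
def operatorLayerYSectE (x : MemberY d ℓ hd hL b₀ b₁ Mstar) (ops : OperatorLayerY d ℓ hd hL b₀ b₁ Mstar 𝔸 G x) (𝔏 : CovLettersY 𝔸 x)
    (𝔢 : SectELettersY 𝔸 x) (𝔴 : RWLettersEY 𝔸 G x) : OperatorLayerY d ℓ hd hL b₀ b₁ Mstar 𝔸 G x :=
  { ops with
    Ck := siteKernelOfOp x.toKIdx (bg9Y 𝔸 G x) (fun U => U) (CkY x 𝔏 𝔢) id id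
    GivenBy3185 := givenBy3185Y x 𝔏 𝔢
    HasRWExpC := hasRWExpCY 𝔴 }

variable {𝔸 G} {x : MemberY d ℓ hd hL b₀ b₁ Mstar} (ops : OperatorLayerY d ℓ hd hL b₀ b₁ Mstar 𝔸 G x) (𝔏 : CovLettersY 𝔸 x)
  (𝔢 : SectELettersY 𝔸 x) (𝔴 : RWLettersEY 𝔸 G x)

/-- ★ `Ck` IS the index-bond kernel reading of `C^{(k)}(Λ; ·)`. [cite: Balaban1985BackgroundPropagators, Thm 3.15 (3.187) p.432, bookkeeping] -/
theorem operatorLayerYSectE_Ck :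
    (operatorLayerYSectE 𝔸 G x ops 𝔏 𝔢 𝔴).Ck = siteKernelOfOp x.toKIdx (bg9Y 𝔸 G x) (fun U => U) (CkY x 𝔏 𝔢) id id := rfl
/-- ★ the kernel entry: `|C^{(k)}(Λ; U; y, y′)| = sup_E ‖(C^{(k)}(Λ; U)(δ_{y′} ⊗ E))(y)‖`. [cite: Balaban1985BackgroundPropagators, Thm 3.15 (3.187) p.432, bookkeeping] -/
theorem operatorLayerYSectE_Ck_ker (U : (bg9Y 𝔸 G x).Cfg) (y y' : (geo9Y x).Site) :
    (operatorLayerYSectE 𝔸 G x ops 𝔏 𝔢 𝔴).Ck.ker U y y' = ⨆ E : BallY 𝔸, ‖CkY x 𝔏 𝔢 U (deltaY y' (E : 𝔸)) y‖ := rfl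
/-- ★ `GivenBy3185` IS the pinned (3.185) slot. [cite: Balaban1985BackgroundPropagators, Thm 3.15 (3.185) p.432, bookkeeping] -/
theorem operatorLayerYSectE_GivenBy3185 : (operatorLayerYSectE 𝔸 G x ops 𝔏 𝔢 𝔴).GivenBy3185 = givenBy3185Y x 𝔏 𝔢 := rfl
/-- ★ `HasRWExpC` IS the pinned expansion slot. [cite: Balaban1985BackgroundPropagators, Thm 3.15 p.432, bookkeeping] -/
theorem operatorLayerYSectE_HasRWExpC : (operatorLayerYSectE 𝔸 G x ops 𝔏 𝔢 𝔴).HasRWExpC = hasRWExpCY 𝔴 := rfl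
/-- unchanged: `Gp`. [cite: Balaban1985BackgroundPropagators, Thm 3.1 p.397, bookkeeping] -/
theorem operatorLayerYSectE_Gp : (operatorLayerYSectE 𝔸 G x ops 𝔏 𝔢 𝔴).Gp = ops.Gp := rfl
/-- unchanged: `GA`. [cite: Balaban1985BackgroundPropagators, Thm 3.3 p.399, bookkeeping] -/
theorem operatorLayerYSectE_GA : (operatorLayerYSectE 𝔸 G x ops 𝔏 𝔢 𝔴).GA = ops.GA := rfl
/-- unchanged: `Cinv`. [cite: Balaban1985BackgroundPropagators, Thm 3.2 p.398, bookkeeping] -/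
theorem operatorLayerYSectE_Cinv : (operatorLayerYSectE 𝔸 G x ops 𝔏 𝔢 𝔴).Cinv = ops.Cinv := rfl
/-- unchanged: `IsAnalyticExt`. [cite: Balaban1985BackgroundPropagators, (3.37) p.396, bookkeeping] -/
theorem operatorLayerYSectE_IsAnalyticExt : (operatorLayerYSectE 𝔸 G x ops 𝔏 𝔢 𝔴).IsAnalyticExt = ops.IsAnalyticExt := rfl
/-- unchanged: `E37`. [cite: Balaban1985BackgroundPropagators, Thm 3.7 p.409, bookkeeping] -/
theorem operatorLayerYSectE_E37 : (operatorLayerYSectE 𝔸 G x ops 𝔏 𝔢 𝔴).E37 = ops.E37 := rfl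
/-- unchanged: `EK39`. [cite: Balaban1985BackgroundPropagators, Thm 3.9 p.413, bookkeeping] -/
theorem operatorLayerYSectE_EK39 : (operatorLayerYSectE 𝔸 G x ops 𝔏 𝔢 𝔴).EK39 = ops.EK39 := rfl
/-- unchanged: `E310`. [cite: Balaban1985BackgroundPropagators, Thm 3.10 p.415, bookkeeping] -/
theorem operatorLayerYSectE_E310 : (operatorLayerYSectE 𝔸 G x ops 𝔏 𝔢 𝔴).E310 = ops.E310 := rfl
/-- unchanged: `PosDef`. [cite: Balaban1985BackgroundPropagators, Thm 3.11 p.417, bookkeeping] -/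
theorem operatorLayerYSectE_PosDef : (operatorLayerYSectE 𝔸 G x ops 𝔏 𝔢 𝔴).PosDef = ops.PosDef := rfl
/-- unchanged: `GD`. [cite: Balaban1985BackgroundPropagators, (3.122) p.420, bookkeeping] -/
theorem operatorLayerYSectE_GD : (operatorLayerYSectE 𝔸 G x ops 𝔏 𝔢 𝔴).GD = ops.GD := rfl
/-- unchanged: `G₁`. [cite: Balaban1985BackgroundPropagators, (3.128) p.421, bookkeeping] -/
theorem operatorLayerYSectE_G₁ : (operatorLayerYSectE 𝔸 G x ops 𝔏 𝔢 𝔴).G₁ = ops.G₁ := rfl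
/-- unchanged: `H`. [cite: Balaban1985BackgroundPropagators, (3.126) p.421, bookkeeping] -/
theorem operatorLayerYSectE_H : (operatorLayerYSectE 𝔸 G x ops 𝔏 𝔢 𝔴).H = ops.H := rfl
/-- unchanged: `H₁`. [cite: Balaban1985BackgroundPropagators, (3.129) p.421, bookkeeping] -/
theorem operatorLayerYSectE_H₁ : (operatorLayerYSectE 𝔸 G x ops 𝔏 𝔢 𝔴).H₁ = ops.H₁ := rfl
/-- unchanged: `HasRWExp`. [cite: Balaban1985BackgroundPropagators, Thm 3.12 p.423, bookkeeping] -/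
theorem operatorLayerYSectE_HasRWExp : (operatorLayerYSectE 𝔸 G x ops 𝔏 𝔢 𝔴).HasRWExp = ops.HasRWExp := rfl
/-- unchanged: `HasRWExpH`. [cite: Balaban1985BackgroundPropagators, Thm 3.12 p.423, bookkeeping] -/
theorem operatorLayerYSectE_HasRWExpH : (operatorLayerYSectE 𝔸 G x ops 𝔏 𝔢 𝔴).HasRWExpH = ops.HasRWExpH := rfl
/-- unchanged: `PosDefK`. [cite: Balaban1985BackgroundPropagators, Thm 3.13 p.426, bookkeeping] -/
theorem operatorLayerYSectE_PosDefK : (operatorLayerYSectE 𝔸 G x ops 𝔏 𝔢 𝔴).PosDefK = ops.PosDefK := rfl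
/-- unchanged: `GG`. [cite: Balaban1985BackgroundPropagators, (3.153) p.426, bookkeeping] -/
theorem operatorLayerYSectE_GG : (operatorLayerYSectE 𝔸 G x ops 𝔏 𝔢 𝔴).GG = ops.GG := rfl
/-- unchanged: `Kdiff`. [cite: Balaban1985BackgroundPropagators, Thm 3.14 p.426, bookkeeping] -/
theorem operatorLayerYSectE_Kdiff : (operatorLayerYSectE 𝔸 G x ops 𝔏 𝔢 𝔴).Kdiff = ops.Kdiff := rfl
/-- unchanged: `P349`. [cite: Balaban1985BackgroundPropagators, (3.49) p.399, bookkeeping] -/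
theorem operatorLayerYSectE_P349 : (operatorLayerYSectE 𝔸 G x ops 𝔏 𝔢 𝔴).P349 = ops.P349 := rfl
/-- unchanged: `QGQinv`. [cite: Balaban1985BackgroundPropagators, (3.132) p.422, bookkeeping] -/
theorem operatorLayerYSectE_QGQinv : (operatorLayerYSectE 𝔸 G x ops 𝔏 𝔢 𝔴).QGQinv = ops.QGQinv := rfl
/-- unchanged: `QG1Qinv`. [cite: Balaban1985BackgroundPropagators, (3.132) p.422, bookkeeping] -/
theorem operatorLayerYSectE_QG1Qinv : (operatorLayerYSectE 𝔸 G x ops 𝔏 𝔢 𝔴).QG1Qinv = ops.QG1Qinv := rfl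

variable (x) in
/-- at the FLAT Sect. E letters the layer's `Ck` kernel vanishes identically (row 24 vacuous there, as at the base layer with a flat `Ck`) — the guard
that separates the typed definition from its content. [cite: Balaban1985BackgroundPropagators, Thm 3.15 (3.187) p.432, bookkeeping] -/
theorem operatorLayerYSectE_Ck_ker_flat (U : (bg9Y 𝔸 G x).Cfg) (y y' : (geo9Y x).Site) :
    (operatorLayerYSectE 𝔸 G x ops 𝔏 (sectELettersY_flat 𝔸 x) 𝔴).Ck.ker U y y' = 0 := by
  haveI : Nonempty (BallY 𝔸) := ballY_nonempty
  rw [operatorLayerYSectE_Ck_ker]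
  have h0 : ∀ E : BallY 𝔸, ‖CkY x 𝔏 (sectELettersY_flat 𝔸 x) U (deltaY y' (E : 𝔸)) y‖ = 0 := fun E => by
    rw [CkY_flat, LinearMap.zero_apply]
    exact norm_zero
  simp_rw [h0]
  exact ciSup_const

end Layer

/-! ## §8 Record level: `SectEY`, `RWEY`, `opsYSectE`, and THE INSTANCE `opsYOfRecordE` -/

section Record

open scoped Matrix.Norms.L2Operator

/-- the Sect. E letters of a Stage 3′(Y) family: one `SectELettersY` per member, `𝔸 = M_N(ℂ)`. [cite: Balaban1985BackgroundPropagators, (3.156)–(3.158) p.428, (3.185)–(3.186) p.432] -/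
abbrev SectEY (N : ℕ) (θ : Stage3Params) (Mstar : ℕ) : Type :=
  ∀ x : MemberY θ.d₆ θ.ℓ₆ θ.hd' θ.hL' θ.b₀ θ.b₁ Mstar, SectELettersY (Matrix (Fin N) (Fin N) ℂ) x

/-- the walk-expansion letters for `C^{(k)}(Λ)` of a Stage 3′(Y) family (`G = SU(N)`). [cite: Balaban1985BackgroundPropagators, Thm 3.15 p.432] -/
abbrev RWEY (N : ℕ) (θ : Stage3Params) (Mstar : ℕ) : Type 1 :=
  ∀ x : MemberY θ.d₆ θ.ℓ₆ θ.hd' θ.hL' θ.b₀ θ.b₁ Mstar, RWLettersEY (Matrix (Fin N) (Fin N) ℂ) (specialUnitaryUnits (Fin N)) x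

/-- the flat Sect. E family (inhabitation). [cite: Balaban1985BackgroundPropagators, (3.156)–(3.158) p.428, bookkeeping] -/
def sectEY_flat (N : ℕ) (θ : Stage3Params) (Mstar : ℕ) : SectEY N θ Mstar := fun x => sectELettersY_flat (Matrix (Fin N) (Fin N) ℂ) x

/-- the flat walk-letter family (inhabitation). [cite: Balaban1985BackgroundPropagators, Thm 3.15 p.432, bookkeeping] -/
def rwEY_flat (N : ℕ) (θ : Stage3Params) (Mstar : ℕ) : RWEY N θ Mstar :=
  fun x => rwLettersEY_flat (Matrix (Fin N) (Fin N) ℂ) (specialUnitaryUnits (Fin N)) x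

/-- ★ **the Sect. E update of an `OpsY` layer family**, member by member `operatorLayerYSectE` — GENERIC in the base family `ops` (def-Y's `opsYOfRecordDE`,
n06-i's `opsYS349OfRecordDE`, …) and in the letters `𝔏` the definition (3.156)–(3.158) reads. [cite: Balaban1985BackgroundPropagators, Thm 3.15 p.432, Thms 3.1–3.15 pp.397–432] -/
def opsYSectE (N : ℕ) (θ : Stage3Params) (Mstar : ℕ) (ops : OpsY N θ Mstar) (𝔏 : LettersY N θ Mstar) (𝔢 : SectEY N θ Mstar) (𝔴 : RWEY N θ Mstar) :
    OpsY N θ Mstar :=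
  fun x => operatorLayerYSectE (Matrix (Fin N) (Fin N) ℂ) (specialUnitaryUnits (Fin N)) x (ops x) (𝔏 x) (𝔢 x) (𝔴 x)

/-- ★★★ **THE `OpsY` INSTANCE OF RECORD WITH THE SECT. E LETTER**: def-Y's v3 instance `opsYOfRecordDE N θ M⋆ 𝔯 𝔈` with `Ck ∕ GivenBy3185 ∕ HasRWExpC`
replaced by the readings of `C^{(k)}(Λ; U)` DEFINED over the v3 letters of record `lettersYOfRecordDE N θ M⋆ 𝔯` and the Sect. E letters `𝔢`, and by the
two pinned slots (walk letters `𝔴`). [cite: Balaban1985BackgroundPropagators, Thm 3.15 (3.185)–(3.187) p.432, (3.156)–(3.158) p.428, Thms 3.1–3.15 pp.397–432] -/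
def opsYOfRecordE (N : ℕ) (θ : Stage3Params) (Mstar : ℕ) (𝔯 : ResY N θ Mstar) (𝔢 : SectEY N θ Mstar) (𝔴 : RWEY N θ Mstar)
    (𝔈 : ExpsY N θ Mstar) : OpsY N θ Mstar :=
  opsYSectE N θ Mstar (opsYOfRecordDE N θ Mstar 𝔯 𝔈) (lettersYOfRecordDE N θ Mstar 𝔯) 𝔢 𝔴

variable (N : ℕ) (θ : Stage3Params) (Mstar : ℕ) (𝔯 : ResY N θ Mstar) (𝔢 : SectEY N θ Mstar) (𝔴 : RWEY N θ Mstar) (𝔈 : ExpsY N θ Mstar)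

/-- the instance at a member, unfolded. [cite: Balaban1985BackgroundPropagators, Thm 3.15 p.432, bookkeeping] -/
theorem opsYOfRecordE_apply (x : MemberY θ.d₆ θ.ℓ₆ θ.hd' θ.hL' θ.b₀ θ.b₁ Mstar) :
    opsYOfRecordE N θ Mstar 𝔯 𝔢 𝔴 𝔈 x =
      operatorLayerYSectE (Matrix (Fin N) (Fin N) ℂ) (specialUnitaryUnits (Fin N)) x (opsYOfRecordDE N θ Mstar 𝔯 𝔈 x)
        (lettersYOfRecordDE N θ Mstar 𝔯 x) (𝔢 x) (𝔴 x) := rfl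

/-- ★ ROW 24's kernel at the instance: the index-bond reading of `C^{(k)}(Λ; ·)` over the v3 LETTERS OF RECORD. [cite: Balaban1985BackgroundPropagators, Thm 3.15 (3.187) p.432, bookkeeping] -/
theorem opsYOfRecordE_Ck (x : MemberY θ.d₆ θ.ℓ₆ θ.hd' θ.hL' θ.b₀ θ.b₁ Mstar) :
    (opsYOfRecordE N θ Mstar 𝔯 𝔢 𝔴 𝔈 x).Ck =
      siteKernelOfOp x.toKIdx (bg9Y (Matrix (Fin N) (Fin N) ℂ) (specialUnitaryUnits (Fin N)) x) (fun U => U)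
        (CkY x (lettersYOfRecordDE N θ Mstar 𝔯 x) (𝔢 x)) id id := rfl

/-- ★ ROW 24's kernel entry at the instance: `|C^{(k)}(Λ; U; y, y′)| = sup_E ‖(C^{(k)}(Λ; U)(δ_{y′} ⊗ E))(y)‖` with `C^{(k)}` over the v3 letters of record
(whose `(QG₁Q*)⁻¹` is FILE 7's `QG1QinvY` over the genuine transport, `G′(U)` and the residual `Δ⁽²⁾`). [cite: Balaban1985BackgroundPropagators, Thm 3.15 (3.187) p.432, bookkeeping] -/
theorem opsYOfRecordE_Ck_ker (x : MemberY θ.d₆ θ.ℓ₆ θ.hd' θ.hL' θ.b₀ θ.b₁ Mstar)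
    (U : (bg9Y (Matrix (Fin N) (Fin N) ℂ) (specialUnitaryUnits (Fin N)) x).Cfg) (y y' : (geo9Y x).Site) :
    (opsYOfRecordE N θ Mstar 𝔯 𝔢 𝔴 𝔈 x).Ck.ker U y y' =
      ⨆ E : BallY (Matrix (Fin N) (Fin N) ℂ), ‖CkY x (lettersYOfRecordDE N θ Mstar 𝔯 x) (𝔢 x) U (deltaY y' (E : Matrix (Fin N) (Fin N) ℂ)) y‖ := rfl

/-- ★ ROW 24's first slot at the instance IS the pinned (3.185) equation over the letters of record. [cite: Balaban1985BackgroundPropagators, Thm 3.15 (3.185) p.432, bookkeeping] -/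
theorem opsYOfRecordE_GivenBy3185 (x : MemberY θ.d₆ θ.ℓ₆ θ.hd' θ.hL' θ.b₀ θ.b₁ Mstar) :
    (opsYOfRecordE N θ Mstar 𝔯 𝔢 𝔴 𝔈 x).GivenBy3185 = givenBy3185Y x (lettersYOfRecordDE N θ Mstar 𝔯 x) (𝔢 x) := rfl

/-- ★ ROW 24's second slot at the instance IS the pinned expansion clause. [cite: Balaban1985BackgroundPropagators, Thm 3.15 p.432, bookkeeping] -/
theorem opsYOfRecordE_HasRWExpC (x : MemberY θ.d₆ θ.ℓ₆ θ.hd' θ.hL' θ.b₀ θ.b₁ Mstar) :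
    (opsYOfRecordE N θ Mstar 𝔯 𝔢 𝔴 𝔈 x).HasRWExpC = hasRWExpCY (𝔴 x) := rfl

/-- the other rows' letters ARE `opsYOfRecordDE`'s: `GA`. [cite: Balaban1985BackgroundPropagators, Thm 3.3 p.399, bookkeeping] -/
theorem opsYOfRecordE_GA (x : MemberY θ.d₆ θ.ℓ₆ θ.hd' θ.hL' θ.b₀ θ.b₁ Mstar) :
    (opsYOfRecordE N θ Mstar 𝔯 𝔢 𝔴 𝔈 x).GA = (opsYOfRecordDE N θ Mstar 𝔯 𝔈 x).GA := rfl
/-- … `Gp`. [cite: Balaban1985BackgroundPropagators, Thm 3.1 p.397, bookkeeping] -/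
theorem opsYOfRecordE_Gp (x : MemberY θ.d₆ θ.ℓ₆ θ.hd' θ.hL' θ.b₀ θ.b₁ Mstar) :
    (opsYOfRecordE N θ Mstar 𝔯 𝔢 𝔴 𝔈 x).Gp = (opsYOfRecordDE N θ Mstar 𝔯 𝔈 x).Gp := rfl
/-- … `Cinv`. [cite: Balaban1985BackgroundPropagators, Thm 3.2 p.398, bookkeeping] -/
theorem opsYOfRecordE_Cinv (x : MemberY θ.d₆ θ.ℓ₆ θ.hd' θ.hL' θ.b₀ θ.b₁ Mstar) :
    (opsYOfRecordE N θ Mstar 𝔯 𝔢 𝔴 𝔈 x).Cinv = (opsYOfRecordDE N θ Mstar 𝔯 𝔈 x).Cinv := rfl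
/-- … `Kdiff` (Thm 3.14's genuine `KdiffY`). [cite: Balaban1985BackgroundPropagators, Thm 3.14 p.426, bookkeeping] -/
theorem opsYOfRecordE_Kdiff (x : MemberY θ.d₆ θ.ℓ₆ θ.hd' θ.hL' θ.b₀ θ.b₁ Mstar) :
    (opsYOfRecordE N θ Mstar 𝔯 𝔢 𝔴 𝔈 x).Kdiff = (opsYOfRecordDE N θ Mstar 𝔯 𝔈 x).Kdiff := rfl
/-- … `GD ∕ G₁ ∕ H ∕ H₁ ∕ GG` (rows 20–21). [cite: Balaban1985BackgroundPropagators, (3.122)–(3.153) pp.420–426, bookkeeping] -/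
theorem opsYOfRecordE_sectD (x : MemberY θ.d₆ θ.ℓ₆ θ.hd' θ.hL' θ.b₀ θ.b₁ Mstar) :
    (opsYOfRecordE N θ Mstar 𝔯 𝔢 𝔴 𝔈 x).GD = (opsYOfRecordDE N θ Mstar 𝔯 𝔈 x).GD ∧
      (opsYOfRecordE N θ Mstar 𝔯 𝔢 𝔴 𝔈 x).G₁ = (opsYOfRecordDE N θ Mstar 𝔯 𝔈 x).G₁ ∧
      (opsYOfRecordE N θ Mstar 𝔯 𝔢 𝔴 𝔈 x).H = (opsYOfRecordDE N θ Mstar 𝔯 𝔈 x).H ∧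
      (opsYOfRecordE N θ Mstar 𝔯 𝔢 𝔴 𝔈 x).H₁ = (opsYOfRecordDE N θ Mstar 𝔯 𝔈 x).H₁ ∧
      (opsYOfRecordE N θ Mstar 𝔯 𝔢 𝔴 𝔈 x).GG = (opsYOfRecordDE N θ Mstar 𝔯 𝔈 x).GG := ⟨rfl, rfl, rfl, rfl, rfl⟩
/-- … `P349` (still flat here; n06-i's `opsYS349OfRecordDE` composes through `opsYSectE`). [cite: Balaban1985BackgroundPropagators, (3.49) p.399, bookkeeping] -/
theorem opsYOfRecordE_P349 (x : MemberY θ.d₆ θ.ℓ₆ θ.hd' θ.hL' θ.b₀ θ.b₁ Mstar) :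
    (opsYOfRecordE N θ Mstar 𝔯 𝔢 𝔴 𝔈 x).P349 = (opsYOfRecordDE N θ Mstar 𝔯 𝔈 x).P349 := rfl
/-- … `QGQinv ∕ QG1Qinv` (row 26). [cite: Balaban1985BackgroundPropagators, (3.132) p.422, bookkeeping] -/
theorem opsYOfRecordE_QGQinv_QG1Qinv (x : MemberY θ.d₆ θ.ℓ₆ θ.hd' θ.hL' θ.b₀ θ.b₁ Mstar) :
    (opsYOfRecordE N θ Mstar 𝔯 𝔢 𝔴 𝔈 x).QGQinv = (opsYOfRecordDE N θ Mstar 𝔯 𝔈 x).QGQinv ∧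
      (opsYOfRecordE N θ Mstar 𝔯 𝔢 𝔴 𝔈 x).QG1Qinv = (opsYOfRecordDE N θ Mstar 𝔯 𝔈 x).QG1Qinv := ⟨rfl, rfl⟩
/-- … the expansion ∕ predicate letters of the other rows (`E37 EK39 E310 PosDef IsAnalyticExt HasRWExp HasRWExpH PosDefK`) are `𝔈`'s.
[cite: Balaban1985BackgroundPropagators, Thms 3.7–3.13 pp.409–426, bookkeeping] -/
theorem opsYOfRecordE_exps (x : MemberY θ.d₆ θ.ℓ₆ θ.hd' θ.hL' θ.b₀ θ.b₁ Mstar) :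
    (opsYOfRecordE N θ Mstar 𝔯 𝔢 𝔴 𝔈 x).E37 = (𝔈 x).E37 ∧ (opsYOfRecordE N θ Mstar 𝔯 𝔢 𝔴 𝔈 x).EK39 = (𝔈 x).EK39 ∧
      (opsYOfRecordE N θ Mstar 𝔯 𝔢 𝔴 𝔈 x).E310 = (𝔈 x).E310 ∧ (opsYOfRecordE N θ Mstar 𝔯 𝔢 𝔴 𝔈 x).PosDef = (𝔈 x).PosDef ∧
      (opsYOfRecordE N θ Mstar 𝔯 𝔢 𝔴 𝔈 x).IsAnalyticExt = (𝔈 x).IsAnalyticExt ∧ (opsYOfRecordE N θ Mstar 𝔯 𝔢 𝔴 𝔈 x).HasRWExp = (𝔈 x).HasRWExp ∧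
      (opsYOfRecordE N θ Mstar 𝔯 𝔢 𝔴 𝔈 x).HasRWExpH = (𝔈 x).HasRWExpH ∧ (opsYOfRecordE N θ Mstar 𝔯 𝔢 𝔴 𝔈 x).PosDefK = (𝔈 x).PosDefK :=
  ⟨rfl, rfl, rfl, rfl, rfl, rfl, rfl, rfl⟩

/-- the [B9] bundle of record at the E instance. [cite: Balaban1985BackgroundPropagators, Thms 3.1–3.15 pp.397–432, bookkeeping] -/
theorem Y9OfRecord_opsYOfRecordE :
    Y9OfRecord N θ Mstar (opsYOfRecordE N θ Mstar 𝔯 𝔢 𝔴 𝔈) =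
      carriersY θ.d₆ θ.ℓ₆ θ.hd' θ.hL' θ.b₀ θ.b₁ Mstar (Matrix (Fin N) (Fin N) ℂ) (specialUnitaryUnits (Fin N)) (opsYOfRecordE N θ Mstar 𝔯 𝔢 𝔴 𝔈) := rfl

/-- at the FLAT Sect. E family the instance's `Ck` kernel vanishes identically (row 24 vacuous there, as at `opsYOfRecordDE`).
[cite: Balaban1985BackgroundPropagators, Thm 3.15 (3.187) p.432, bookkeeping] -/
theorem opsYOfRecordE_Ck_ker_flat (x : MemberY θ.d₆ θ.ℓ₆ θ.hd' θ.hL' θ.b₀ θ.b₁ Mstar)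
    (U : (bg9Y (Matrix (Fin N) (Fin N) ℂ) (specialUnitaryUnits (Fin N)) x).Cfg) (y y' : (geo9Y x).Site) :
    (opsYOfRecordE N θ Mstar 𝔯 (sectEY_flat N θ Mstar) 𝔴 𝔈 x).Ck.ker U y y' = 0 :=
  operatorLayerYSectE_Ck_ker_flat x (opsYOfRecordDE N θ Mstar 𝔯 𝔈 x) (lettersYOfRecordDE N θ Mstar 𝔯 x) (𝔴 x) U y y'

/-! ### §8b THE INSTANCE OF RECORD FOR THE N06 KNIT: rows 24 AND 25 genuine (`opsYSectE` over n06-i's `opsYS349OfRecordDE`) -/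

/-- ★★★ **THE `OpsY` INSTANCE OF RECORD FOR THE N06 CERTIFICATE**: n06-i's `opsYS349OfRecordDE N θ M⋆ 𝔯 𝔈` (= def-Y's v3 instance with the GENUINE
site-sector (3.49) reading `p349SiteY` in `P349`, `B9Ineq349SiteReading`, p495350) updated by `opsYSectE` — so `P349` (row 25) AND `Ck ∕ GivenBy3185 ∕
HasRWExpC` (row 24) are genuine readings, every other field is `opsYOfRecordDE`'s (`rfl`).  This is the layer dag-n06-d's certificate should be
instantiated at. [cite: Balaban1985BackgroundPropagators, Thm 3.15 (3.185)–(3.187) p.432, (3.49) p.399, Thms 3.1–3.15 pp.397–432] -/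
def opsYOfRecordES (N : ℕ) (θ : Stage3Params) (Mstar : ℕ) (𝔯 : ResY N θ Mstar) (𝔢 : SectEY N θ Mstar) (𝔴 : RWEY N θ Mstar)
    (𝔈 : ExpsY N θ Mstar) : OpsY N θ Mstar :=
  opsYSectE N θ Mstar (opsYS349OfRecordDE N θ Mstar 𝔯 𝔈) (lettersYOfRecordDE N θ Mstar 𝔯) 𝔢 𝔴

/-- the instance of record at a member, unfolded. [cite: Balaban1985BackgroundPropagators, Thm 3.15 p.432, bookkeeping] -/
theorem opsYOfRecordES_apply (x : MemberY θ.d₆ θ.ℓ₆ θ.hd' θ.hL' θ.b₀ θ.b₁ Mstar) :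
    opsYOfRecordES N θ Mstar 𝔯 𝔢 𝔴 𝔈 x =
      operatorLayerYSectE (Matrix (Fin N) (Fin N) ℂ) (specialUnitaryUnits (Fin N)) x (opsYS349OfRecordDE N θ Mstar 𝔯 𝔈 x)
        (lettersYOfRecordDE N θ Mstar 𝔯 x) (𝔢 x) (𝔴 x) := rfl

/-- ★ ROW 24's kernel at the instance of record (the same reading as at `opsYOfRecordE`). [cite: Balaban1985BackgroundPropagators, Thm 3.15 (3.187) p.432, bookkeeping] -/
theorem opsYOfRecordES_Ck (x : MemberY θ.d₆ θ.ℓ₆ θ.hd' θ.hL' θ.b₀ θ.b₁ Mstar) :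
    (opsYOfRecordES N θ Mstar 𝔯 𝔢 𝔴 𝔈 x).Ck =
      siteKernelOfOp x.toKIdx (bg9Y (Matrix (Fin N) (Fin N) ℂ) (specialUnitaryUnits (Fin N)) x) (fun U => U)
        (CkY x (lettersYOfRecordDE N θ Mstar 𝔯 x) (𝔢 x)) id id := rfl

/-- ★ ROW 24's kernel entry at the instance of record. [cite: Balaban1985BackgroundPropagators, Thm 3.15 (3.187) p.432, bookkeeping] -/
theorem opsYOfRecordES_Ck_ker (x : MemberY θ.d₆ θ.ℓ₆ θ.hd' θ.hL' θ.b₀ θ.b₁ Mstar)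
    (U : (bg9Y (Matrix (Fin N) (Fin N) ℂ) (specialUnitaryUnits (Fin N)) x).Cfg) (y y' : (geo9Y x).Site) :
    (opsYOfRecordES N θ Mstar 𝔯 𝔢 𝔴 𝔈 x).Ck.ker U y y' =
      ⨆ E : BallY (Matrix (Fin N) (Fin N) ℂ), ‖CkY x (lettersYOfRecordDE N θ Mstar 𝔯 x) (𝔢 x) U (deltaY y' (E : Matrix (Fin N) (Fin N) ℂ)) y‖ := rfl

/-- ★ ROW 24's (3.185) slot at the instance of record. [cite: Balaban1985BackgroundPropagators, Thm 3.15 (3.185) p.432, bookkeeping] -/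
theorem opsYOfRecordES_GivenBy3185 (x : MemberY θ.d₆ θ.ℓ₆ θ.hd' θ.hL' θ.b₀ θ.b₁ Mstar) :
    (opsYOfRecordES N θ Mstar 𝔯 𝔢 𝔴 𝔈 x).GivenBy3185 = givenBy3185Y x (lettersYOfRecordDE N θ Mstar 𝔯 x) (𝔢 x) := rfl

/-- ★ ROW 24's expansion slot at the instance of record. [cite: Balaban1985BackgroundPropagators, Thm 3.15 p.432, bookkeeping] -/
theorem opsYOfRecordES_HasRWExpC (x : MemberY θ.d₆ θ.ℓ₆ θ.hd' θ.hL' θ.b₀ θ.b₁ Mstar) :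
    (opsYOfRecordES N θ Mstar 𝔯 𝔢 𝔴 𝔈 x).HasRWExpC = hasRWExpCY (𝔴 x) := rfl

/-- ★ ROW 25's letter at the instance of record IS n06-i's genuine site-sector (3.49) reading. [cite: Balaban1985BackgroundPropagators, (3.49) p.399, bookkeeping] -/
theorem opsYOfRecordES_P349 (x : MemberY θ.d₆ θ.ℓ₆ θ.hd' θ.hL' θ.b₀ θ.b₁ Mstar) :
    (opsYOfRecordES N θ Mstar 𝔯 𝔢 𝔴 𝔈 x).P349 =
      p349SiteY (Matrix (Fin N) (Fin N) ℂ) (specialUnitaryUnits (Fin N)) x (lettersYOfRecordDE N θ Mstar 𝔯 x) := rfl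

/-- the other rows' operator letters at the instance of record ARE `opsYOfRecordDE`'s (`Gp GA Cinv GD G₁ H H₁ GG Kdiff QGQinv QG1Qinv`, `rfl` through both
layers) — rows 4–12, 17, 20–23, 26 transport verbatim. [cite: Balaban1985BackgroundPropagators, Thms 3.1–3.14 pp.397–426, (3.132) p.422, bookkeeping] -/
theorem opsYOfRecordES_letters (x : MemberY θ.d₆ θ.ℓ₆ θ.hd' θ.hL' θ.b₀ θ.b₁ Mstar) :
    (opsYOfRecordES N θ Mstar 𝔯 𝔢 𝔴 𝔈 x).Gp = (opsYOfRecordDE N θ Mstar 𝔯 𝔈 x).Gp ∧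
      (opsYOfRecordES N θ Mstar 𝔯 𝔢 𝔴 𝔈 x).GA = (opsYOfRecordDE N θ Mstar 𝔯 𝔈 x).GA ∧
      (opsYOfRecordES N θ Mstar 𝔯 𝔢 𝔴 𝔈 x).Cinv = (opsYOfRecordDE N θ Mstar 𝔯 𝔈 x).Cinv ∧
      (opsYOfRecordES N θ Mstar 𝔯 𝔢 𝔴 𝔈 x).GD = (opsYOfRecordDE N θ Mstar 𝔯 𝔈 x).GD ∧
      (opsYOfRecordES N θ Mstar 𝔯 𝔢 𝔴 𝔈 x).G₁ = (opsYOfRecordDE N θ Mstar 𝔯 𝔈 x).G₁ ∧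
      (opsYOfRecordES N θ Mstar 𝔯 𝔢 𝔴 𝔈 x).H = (opsYOfRecordDE N θ Mstar 𝔯 𝔈 x).H ∧
      (opsYOfRecordES N θ Mstar 𝔯 𝔢 𝔴 𝔈 x).H₁ = (opsYOfRecordDE N θ Mstar 𝔯 𝔈 x).H₁ ∧
      (opsYOfRecordES N θ Mstar 𝔯 𝔢 𝔴 𝔈 x).GG = (opsYOfRecordDE N θ Mstar 𝔯 𝔈 x).GG ∧
      (opsYOfRecordES N θ Mstar 𝔯 𝔢 𝔴 𝔈 x).Kdiff = (opsYOfRecordDE N θ Mstar 𝔯 𝔈 x).Kdiff ∧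
      (opsYOfRecordES N θ Mstar 𝔯 𝔢 𝔴 𝔈 x).QGQinv = (opsYOfRecordDE N θ Mstar 𝔯 𝔈 x).QGQinv ∧
      (opsYOfRecordES N θ Mstar 𝔯 𝔢 𝔴 𝔈 x).QG1Qinv = (opsYOfRecordDE N θ Mstar 𝔯 𝔈 x).QG1Qinv :=
  ⟨rfl, rfl, rfl, rfl, rfl, rfl, rfl, rfl, rfl, rfl, rfl⟩

/-- … and its expansion ∕ predicate letters are `𝔈`'s. [cite: Balaban1985BackgroundPropagators, Thms 3.7–3.13 pp.409–426, bookkeeping] -/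
theorem opsYOfRecordES_exps (x : MemberY θ.d₆ θ.ℓ₆ θ.hd' θ.hL' θ.b₀ θ.b₁ Mstar) :
    (opsYOfRecordES N θ Mstar 𝔯 𝔢 𝔴 𝔈 x).E37 = (𝔈 x).E37 ∧ (opsYOfRecordES N θ Mstar 𝔯 𝔢 𝔴 𝔈 x).EK39 = (𝔈 x).EK39 ∧
      (opsYOfRecordES N θ Mstar 𝔯 𝔢 𝔴 𝔈 x).E310 = (𝔈 x).E310 ∧ (opsYOfRecordES N θ Mstar 𝔯 𝔢 𝔴 𝔈 x).PosDef = (𝔈 x).PosDef ∧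
      (opsYOfRecordES N θ Mstar 𝔯 𝔢 𝔴 𝔈 x).IsAnalyticExt = (𝔈 x).IsAnalyticExt ∧ (opsYOfRecordES N θ Mstar 𝔯 𝔢 𝔴 𝔈 x).HasRWExp = (𝔈 x).HasRWExp ∧
      (opsYOfRecordES N θ Mstar 𝔯 𝔢 𝔴 𝔈 x).HasRWExpH = (𝔈 x).HasRWExpH ∧ (opsYOfRecordES N θ Mstar 𝔯 𝔢 𝔴 𝔈 x).PosDefK = (𝔈 x).PosDefK :=
  ⟨rfl, rfl, rfl, rfl, rfl, rfl, rfl, rfl⟩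

/-- the two E instances differ only in `P349`: same `Ck ∕ GivenBy3185 ∕ HasRWExpC`. [cite: Balaban1985BackgroundPropagators, Thm 3.15 p.432, (3.49) p.399, bookkeeping] -/
theorem opsYOfRecordES_row24_eq_opsYOfRecordE (x : MemberY θ.d₆ θ.ℓ₆ θ.hd' θ.hL' θ.b₀ θ.b₁ Mstar) :
    (opsYOfRecordES N θ Mstar 𝔯 𝔢 𝔴 𝔈 x).Ck = (opsYOfRecordE N θ Mstar 𝔯 𝔢 𝔴 𝔈 x).Ck ∧
      (opsYOfRecordES N θ Mstar 𝔯 𝔢 𝔴 𝔈 x).GivenBy3185 = (opsYOfRecordE N θ Mstar 𝔯 𝔢 𝔴 𝔈 x).GivenBy3185 ∧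
      (opsYOfRecordES N θ Mstar 𝔯 𝔢 𝔴 𝔈 x).HasRWExpC = (opsYOfRecordE N θ Mstar 𝔯 𝔢 𝔴 𝔈 x).HasRWExpC := ⟨rfl, rfl, rfl⟩

/-- the [B9] bundle of record at the instance of record. [cite: Balaban1985BackgroundPropagators, Thms 3.1–3.15 pp.397–432, bookkeeping] -/
theorem Y9OfRecord_opsYOfRecordES :
    Y9OfRecord N θ Mstar (opsYOfRecordES N θ Mstar 𝔯 𝔢 𝔴 𝔈) =
      carriersY θ.d₆ θ.ℓ₆ θ.hd' θ.hL' θ.b₀ θ.b₁ Mstar (Matrix (Fin N) (Fin N) ℂ) (specialUnitaryUnits (Fin N)) (opsYOfRecordES N θ Mstar 𝔯 𝔢 𝔴 𝔈) := rfl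

/-- at the FLAT Sect. E family the instance of record's `Ck` kernel vanishes identically (row 24 vacuous there).
[cite: Balaban1985BackgroundPropagators, Thm 3.15 (3.187) p.432, bookkeeping] -/
theorem opsYOfRecordES_Ck_ker_flat (x : MemberY θ.d₆ θ.ℓ₆ θ.hd' θ.hL' θ.b₀ θ.b₁ Mstar)
    (U : (bg9Y (Matrix (Fin N) (Fin N) ℂ) (specialUnitaryUnits (Fin N)) x).Cfg) (y y' : (geo9Y x).Site) :
    (opsYOfRecordES N θ Mstar 𝔯 (sectEY_flat N θ Mstar) 𝔴 𝔈 x).Ck.ker U y y' = 0 :=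
  operatorLayerYSectE_Ck_ker_flat x (opsYS349OfRecordDE N θ Mstar 𝔯 𝔈 x) (lettersYOfRecordDE N θ Mstar 𝔯 x) (𝔴 x) U y y'

/-! ### §8c Row 24's face at the instance of record, unfolded; and its outright vacuity at the FLAT Sect. E letters (the honesty guard) -/

/-- ★ **ROW 24 (`t315`) AT THE INSTANCE OF RECORD, UNFOLDED** (`Iff.rfl`): r1's `Thm315FullPrinted` at `opsYOfRecordES` IS the printed Theorem 3.15 about
the index-bond kernel of `C^{(k)}(Λ; U) = CkY` DEFINED by (3.156)–(3.158) over the v3 letters of record and the Sect. E letters `𝔢`, with «given by the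
formula (3.185)» = `givenBy3185Y` and the expansion clause = `hasRWExpCY (𝔴 x)` — the NAMED binder the N06 certificate displays for row 24.
[cite: Balaban1985BackgroundPropagators, Thm 3.15 (3.185)–(3.187) p.432] -/
theorem t315_opsYOfRecordES_iff :
    B9.Thm315FullPrinted c35Y geo9Y (bg9Y (Matrix (Fin N) (Fin N) ℂ) (specialUnitaryUnits (Fin N)))
        (fun x => (opsYOfRecordES N θ Mstar 𝔯 𝔢 𝔴 𝔈 x).Ck) inΛY unitDistY
        (fun x => (opsYOfRecordES N θ Mstar 𝔯 𝔢 𝔴 𝔈 x).GivenBy3185) (fun x => (opsYOfRecordES N θ Mstar 𝔯 𝔢 𝔴 𝔈 x).HasRWExpC) ↔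
      B9.Thm315FullPrinted c35Y geo9Y (bg9Y (Matrix (Fin N) (Fin N) ℂ) (specialUnitaryUnits (Fin N)))
        (fun x => siteKernelOfOp x.toKIdx (bg9Y (Matrix (Fin N) (Fin N) ℂ) (specialUnitaryUnits (Fin N)) x) (fun U => U)
          (CkY x (lettersYOfRecordDE N θ Mstar 𝔯 x) (𝔢 x)) id id) inΛY unitDistY
        (fun x => givenBy3185Y x (lettersYOfRecordDE N θ Mstar 𝔯 x) (𝔢 x)) (fun x => hasRWExpCY (𝔴 x)) := Iff.rfl

/-- THE HONESTY GUARD: at the FLAT Sect. E letters and the FLAT walk letters row 24 holds OUTRIGHT at the instance of record (kernel `0`, both slots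
trivially inhabited: `opsYOfRecordES_Ck_ker_flat`, `givenBy3185Y_flat`, `hasRWExpCY_flat`) — so the row carries content exactly for GENUINE Sect. E
letters (the successor brick (M-E1)), never by the typing alone. [cite: Balaban1985BackgroundPropagators, Thm 3.15 (3.185)–(3.187) p.432, bookkeeping] -/
theorem t315_opsYOfRecordES_flat {δ₀ : ℝ} (hδ₀ : 0 < δ₀) :
    B9.Thm315FullPrinted c35Y geo9Y (bg9Y (Matrix (Fin N) (Fin N) ℂ) (specialUnitaryUnits (Fin N)))
      (fun x => (opsYOfRecordES N θ Mstar 𝔯 (sectEY_flat N θ Mstar) (rwEY_flat N θ Mstar) 𝔈 x).Ck) inΛY unitDistY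
      (fun x => (opsYOfRecordES N θ Mstar 𝔯 (sectEY_flat N θ Mstar) (rwEY_flat N θ Mstar) 𝔈 x).GivenBy3185)
      (fun x => (opsYOfRecordES N θ Mstar 𝔯 (sectEY_flat N θ Mstar) (rwEY_flat N θ Mstar) 𝔈 x).HasRWExpC) :=
  ⟨δ₀, 1, 1, hδ₀, one_pos, one_pos, fun x _ _ _ U _ _ =>
    ⟨givenBy3185Y_flat x _ U, hasRWExpCY_flat _ _ x U δ₀, fun y y' _ _ => by
      rw [opsYOfRecordES_Ck_ker_flat, abs_zero]
      exact mul_nonneg zero_le_one (Real.exp_nonneg _)⟩⟩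

end Record

end Literature.MathematicalPhysics.QuantumFieldTheory.Balaban1983to89.Node00
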